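import Literature.Analysis.FluidPDE.JiaSverak2014LocalisedData
import Literature.Analysis.FluidPDE.JiaSverak2014BootstrapTools
import Literature.Analysis.FluidPDE.HeatPotentialSliceForm
import Literature.Analysis.FluidPDE.OffDiagonalHeatSmoothing
import Literature.Analysis.UnboundedOperators.HeatDuhamelSliceLevel
import Literature.Analysis.FluidPDE.SuitableWeakRightContinuity
import HarnessLib

/-!
# Jia–Šverák 2014, local higher regularity: the slice structure of a bootstrap level

Analysis/FluidPDE proofs file (theorems only; no definitions, no named facts), part of the proof
of the named fact `Literature.Analysis.FluidPDE.jia_sverak_2014_local_higher_regularity`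
(`JiaSverak2014LocalRegularity.lean`; H. Jia, V. Šverák, Invent. Math. 196 (2014) =
arXiv:1204.0529, §3 Thm 3.2 and the bootstrap remark after its proof, p. 9). The higher
derivative estimates near `t = 0` are obtained "by bootstrap arguments" from the localised
Duhamel formula `u = ∫₀ᵗ e^{Δ(t-s)}[-div(u⊗uη) - ∇(pη)] ds + e^{Δt}(u₀η) + shell terms`. One level of
the bootstrap takes a representative `R` of `u` with `C^{n,γ}` slices on a ball and produces one
with `C^{n+1,γ}` slices on a smaller ball; this file isolates the first half of a level, the
*slice structure*: for a.e. time `t`, on the inner ball, `u_k(t) = V_k(t) - ∂_kQ(t)` weakly, with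
`V_k(t) ∈ C^{n+1,γ}` (universal bounds) and `Q(t) ∈ L¹` (universal bound) — the pressure enters
only through the gradient of the scalar potential `Q = W₊⊛(χp)`, to be removed by the elliptic
step of the second half (`div u = 0`).

* `level_add`, `level_neg`, `level_mono`, `level_sum3`, `level_zero`, `level_of_succ_bound`,
  `level_fderiv_apply` — bookkeeping of `C^{m,γ}` bounds;
* `measurable_caloric` — measurability of the caloric term on space–time;
* `exists_slice_structure` — the statement (docstring of the theorem): the shell terms of the
  localised formula (`exists_localised_data`) are smoothed off the diagonal
  (`OffDiagHeat.exists_offDiagonal_smoothing`), the caloric term keeps the bounds of `χu₀`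
  (`caloric_level_bounds`), the inner terms `χRᵢR_k` gain a derivative in the slice Duhamel
  integral (`HeatHolder.exists_duhamel_level_bounds`), the gradient-multiplier potentials are
  traded for heat potentials against `∂ᵢφ` (`HeatPotentialSlice.ae_slice_weak_representation`),
  and the slice identity is read off for a.e. `t`.

## References

* H. Jia, V. Šverák, Invent. Math. 196 (2014) = arXiv:1204.0529, §3 (p. 9). Bib key
  `JiaSverak2014`.
* L. Caffarelli, R. Kohn, L. Nirenberg, Comm. Pure Appl. Math. 35 (1982), §2. Bib key
  `CaffarelliKohnNirenberg1982`.
-/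

noncomputable section

open MeasureTheory TopologicalSpace Set Function Filter Metric
open _root_.Topology
open scoped ENNReal NNReal RealInnerProductSpace Laplacian

namespace Literature.Analysis.FluidPDE

namespace JiaSverak2014

open Literature.Analysis.UnboundedOperators LemarieRieusset2016

-- nested operator types
set_option maxSynthPendingDepth 3

/-! ## Bookkeeping of `C^{n+1,γ}` bounds under sums -/

/-- Sum of two functions with level bounds. [folklore] -/
theorem level_add {F : Type*} [NormedAddCommGroup F] [NormedSpace ℝ F] {m : ℕ} {γ Mf Mg : ℝ}
    {f g : (EuclideanSpace ℝ (Fin 3)) → F}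
    (hf : ContDiff ℝ m f) (hfb : ∀ k ≤ m, ∀ x, ‖iteratedFDeriv ℝ k f x‖ ≤ Mf)
    (hfH : ∀ x y, ‖iteratedFDeriv ℝ m f x - iteratedFDeriv ℝ m f y‖ ≤ Mf * ‖x - y‖ ^ γ)
    (hg : ContDiff ℝ m g) (hgb : ∀ k ≤ m, ∀ x, ‖iteratedFDeriv ℝ k g x‖ ≤ Mg)
    (hgH : ∀ x y, ‖iteratedFDeriv ℝ m g x - iteratedFDeriv ℝ m g y‖ ≤ Mg * ‖x - y‖ ^ γ) :
    ContDiff ℝ m (fun x => f x + g x) ∧ (∀ k ≤ m, ∀ x, ‖iteratedFDeriv ℝ k (fun x => f x + g x) x‖ ≤ Mf + Mg) ∧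
      ∀ x y, ‖iteratedFDeriv ℝ m (fun x => f x + g x) x - iteratedFDeriv ℝ m (fun x => f x + g x) y‖ ≤
        (Mf + Mg) * ‖x - y‖ ^ γ := by
  have hk : ∀ k ≤ m, ∀ x, iteratedFDeriv ℝ k (fun x => f x + g x) x = iteratedFDeriv ℝ k f x + iteratedFDeriv ℝ k g x := by
    intro k hk x
    exact iteratedFDeriv_add_apply ((hf.of_le (by exact_mod_cast hk)).contDiffAt) ((hg.of_le (by exact_mod_cast hk)).contDiffAt)
  refine ⟨hf.add hg, fun k hk' x => ?_, fun x y => ?_⟩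
  · rw [hk k hk' x]; exact (norm_add_le _ _).trans (add_le_add (hfb k hk' x) (hgb k hk' x))
  · rw [hk m le_rfl x, hk m le_rfl y, add_sub_add_comm, add_mul]
    exact (norm_add_le _ _).trans (add_le_add (hfH x y) (hgH x y))

/-- Negation keeps level bounds. [folklore] -/
theorem level_neg {F : Type*} [NormedAddCommGroup F] [NormedSpace ℝ F] {m : ℕ} {γ Mf : ℝ}
    {f : (EuclideanSpace ℝ (Fin 3)) → F}
    (hf : ContDiff ℝ m f) (hfb : ∀ k ≤ m, ∀ x, ‖iteratedFDeriv ℝ k f x‖ ≤ Mf)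
    (hfH : ∀ x y, ‖iteratedFDeriv ℝ m f x - iteratedFDeriv ℝ m f y‖ ≤ Mf * ‖x - y‖ ^ γ) :
    ContDiff ℝ m (fun x => -f x) ∧ (∀ k ≤ m, ∀ x, ‖iteratedFDeriv ℝ k (fun x => -f x) x‖ ≤ Mf) ∧
      ∀ x y, ‖iteratedFDeriv ℝ m (fun x => -f x) x - iteratedFDeriv ℝ m (fun x => -f x) y‖ ≤ Mf * ‖x - y‖ ^ γ := by
  have hk : ∀ k x, iteratedFDeriv ℝ k (fun x => -f x) x = -iteratedFDeriv ℝ k f x := fun k x =>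
    iteratedFDeriv_neg_apply (f := f)
  refine ⟨hf.neg, fun k hk' x => ?_, fun x y => ?_⟩
  · rw [hk, norm_neg]; exact hfb k hk' x
  · rw [hk, hk]
    calc ‖-iteratedFDeriv ℝ m f x - -iteratedFDeriv ℝ m f y‖ = ‖iteratedFDeriv ℝ m f x - iteratedFDeriv ℝ m f y‖ := by
          rw [neg_sub_neg, norm_sub_rev]
      _ ≤ _ := hfH x y

/-- Enlarging the constant. [folklore] -/
theorem level_mono {F : Type*} [NormedAddCommGroup F] [NormedSpace ℝ F] {m : ℕ} {γ Mf M : ℝ}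
    {f : (EuclideanSpace ℝ (Fin 3)) → F} (hM : Mf ≤ M)
    (hfb : ∀ k ≤ m, ∀ x, ‖iteratedFDeriv ℝ k f x‖ ≤ Mf)
    (hfH : ∀ x y, ‖iteratedFDeriv ℝ m f x - iteratedFDeriv ℝ m f y‖ ≤ Mf * ‖x - y‖ ^ γ) :
    (∀ k ≤ m, ∀ x, ‖iteratedFDeriv ℝ k f x‖ ≤ M) ∧
      ∀ x y, ‖iteratedFDeriv ℝ m f x - iteratedFDeriv ℝ m f y‖ ≤ M * ‖x - y‖ ^ γ :=
  ⟨fun k hk x => (hfb k hk x).trans hM, fun x y =>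
    (hfH x y).trans (mul_le_mul_of_nonneg_right hM (Real.rpow_nonneg (norm_nonneg _) _))⟩

/-- `C^{m+1}` functions with all derivatives up to `m + 1` bounded by `B` have level-`m` bounds
`max B (2B) = 2B`… precisely: `‖Dᵏ‖ ≤ B` (`k ≤ m`) and `[Dᵐ]_γ ≤ max B (2B)` for `γ ≤ 1`
(Lipschitz by the mean value inequality, then `holder_of_lipschitz_of_bound`). [folklore] -/
theorem level_of_succ_bound {F : Type*} [NormedAddCommGroup F] [NormedSpace ℝ F] {m : ℕ} {γ B : ℝ}
    {f : (EuclideanSpace ℝ (Fin 3)) → F} (hf : ContDiff ℝ (m + 1) f)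
    (hB : ∀ k ≤ m + 1, ∀ x, ‖iteratedFDeriv ℝ k f x‖ ≤ B) (hγ0 : 0 < γ) (hγ1 : γ ≤ 1) :
    ContDiff ℝ m f ∧ (∀ k ≤ m, ∀ x, ‖iteratedFDeriv ℝ k f x‖ ≤ 2 * B) ∧
      ∀ x y, ‖iteratedFDeriv ℝ m f x - iteratedFDeriv ℝ m f y‖ ≤ 2 * B * ‖x - y‖ ^ γ :=
  HolderLeibniz.hyp_of_succ hf hB hγ0 hγ1


/-- Sum over `Fin 3` of functions with a common level bound. [folklore] -/
theorem level_sum3 {F : Type*} [NormedAddCommGroup F] [NormedSpace ℝ F] {m : ℕ} {γ M : ℝ}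
    {f : Fin 3 → (EuclideanSpace ℝ (Fin 3)) → F}
    (hf : ∀ i, ContDiff ℝ m (f i)) (hfb : ∀ i, ∀ k ≤ m, ∀ x, ‖iteratedFDeriv ℝ k (f i) x‖ ≤ M)
    (hfH : ∀ i x y, ‖iteratedFDeriv ℝ m (f i) x - iteratedFDeriv ℝ m (f i) y‖ ≤ M * ‖x - y‖ ^ γ) :
    ContDiff ℝ m (fun x => ∑ i, f i x) ∧ (∀ k ≤ m, ∀ x, ‖iteratedFDeriv ℝ k (fun x => ∑ i, f i x) x‖ ≤ 3 * M) ∧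
      ∀ x y, ‖iteratedFDeriv ℝ m (fun x => ∑ i, f i x) x - iteratedFDeriv ℝ m (fun x => ∑ i, f i x) y‖ ≤
        3 * M * ‖x - y‖ ^ γ := by
  have e : (fun x => ∑ i, f i x) = fun x => (f 0 x + f 1 x) + f 2 x := by
    funext x; simp [Fin.sum_univ_three]
  rw [e]
  obtain ⟨h1, h2, h3⟩ := level_add (hf 0) (hfb 0) (hfH 0) (hf 1) (hfb 1) (hfH 1)
  obtain ⟨h4, h5, h6⟩ := level_add h1 h2 h3 (hf 2) (hfb 2) (hfH 2)
  rw [show M + M + M = 3 * M by ring] at h5 h6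
  exact ⟨h4, h5, h6⟩

/-- The zero function has level bounds `0`. [folklore] -/
theorem level_zero {F : Type*} [NormedAddCommGroup F] [NormedSpace ℝ F] {m : ℕ} {γ : ℝ} :
    ContDiff ℝ m (fun _ : EuclideanSpace ℝ (Fin 3) => (0 : F)) ∧
    (∀ k ≤ m, ∀ x, ‖iteratedFDeriv ℝ k (fun _ : EuclideanSpace ℝ (Fin 3) => (0 : F)) x‖ ≤ 0) ∧
      ∀ x y, ‖iteratedFDeriv ℝ m (fun _ : EuclideanSpace ℝ (Fin 3) => (0 : F)) x -
        iteratedFDeriv ℝ m (fun _ : EuclideanSpace ℝ (Fin 3) => (0 : F)) y‖ ≤ 0 * ‖x - y‖ ^ γ := by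
  refine ⟨contDiff_const, fun k hk x => ?_, fun x y => ?_⟩
  · rw [iteratedFDeriv_fun_zero]; simp
  · rw [iteratedFDeriv_fun_zero]; simp

/-- Directional derivative of a function with level-`(m+1)` bounds has level-`m` bounds (unit
direction). [folklore] -/
theorem level_fderiv_apply {F : Type*} [NormedAddCommGroup F] [NormedSpace ℝ F] {m : ℕ} {γ M : ℝ}
    {f : (EuclideanSpace ℝ (Fin 3)) → F} (hf : ContDiff ℝ (m + 1) f)
    (hfb : ∀ k ≤ m + 1, ∀ x, ‖iteratedFDeriv ℝ k f x‖ ≤ M)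
    (hfH : ∀ x y, ‖iteratedFDeriv ℝ (m + 1) f x - iteratedFDeriv ℝ (m + 1) f y‖ ≤ M * ‖x - y‖ ^ γ)
    {v : EuclideanSpace ℝ (Fin 3)} (hv : ‖v‖ ≤ 1) :
    ContDiff ℝ m (fun y => fderiv ℝ f y v) ∧ (∀ k ≤ m, ∀ x, ‖iteratedFDeriv ℝ k (fun y => fderiv ℝ f y v) x‖ ≤ M) ∧
      ∀ x y, ‖iteratedFDeriv ℝ m (fun y => fderiv ℝ f y v) x - iteratedFDeriv ℝ m (fun y => fderiv ℝ f y v) y‖ ≤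
        M * ‖x - y‖ ^ γ := by
  have hM : 0 ≤ M := (norm_nonneg _).trans (hfb 0 (Nat.zero_le _) 0)
  refine ⟨HeatHolder.contDiff_fderiv_apply_const hf v, fun k hk x => ?_, fun x y => ?_⟩
  · have hk1 : ContDiff ℝ (k + 1) f := hf.of_le (by exact_mod_cast Nat.succ_le_succ hk)
    calc _ ≤ ‖v‖ * ‖iteratedFDeriv ℝ (k + 1) f x‖ := norm_iteratedFDeriv_fderiv_apply_le hk1 v x
      _ ≤ 1 * M := mul_le_mul hv (hfb (k + 1) (by omega) x) (norm_nonneg _) zero_le_one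
      _ = M := one_mul _
  · calc _ ≤ ‖v‖ * ‖iteratedFDeriv ℝ (m + 1) f x - iteratedFDeriv ℝ (m + 1) f y‖ := norm_iteratedFDeriv_fderiv_apply_sub_le hf v x y
      _ ≤ 1 * (M * ‖x - y‖ ^ γ) := mul_le_mul hv (hfH x y) (norm_nonneg _) zero_le_one
      _ = _ := one_mul _

/-! ## Measurability of the caloric term -/

/-- The caloric term `(t, x) ↦ e^{tΔ}g(x)` (`t > 0`), `g(x)` (`t ≤ 0`), of a continuous bounded
real `g` is measurable on `ℝ × ℝ³`. [folklore] -/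
theorem measurable_caloric {g : (EuclideanSpace ℝ (Fin 3)) → ℝ} (hg : Continuous g) :
    Measurable fun w : ℝ × EuclideanSpace ℝ (Fin 3) => if 0 < w.1 then heatExtension g w.1 w.2 else g w.2 := by
  have h1 : Measurable fun w : ℝ × EuclideanSpace ℝ (Fin 3) => heatExtension g w.1 w.2 := by
    have e : (fun w : ℝ × EuclideanSpace ℝ (Fin 3) => heatExtension g w.1 w.2) =
        fun w => ∫ y, heatKernel w.1 y • g (w.2 - y) := by
      funext w; rw [heatExtension_apply]
    rw [e]
    have hI : Measurable fun p : (ℝ × EuclideanSpace ℝ (Fin 3)) × EuclideanSpace ℝ (Fin 3) =>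
        heatKernel p.1.1 p.2 • g (p.1.2 - p.2) :=
      (measurable_uncurry_heatKernel.comp (measurable_fst.fst.prodMk measurable_snd)).smul
        (hg.measurable.comp (measurable_fst.snd.sub measurable_snd))
    exact (hI.stronglyMeasurable.integral_prod_right').measurable
  have h2 : Measurable fun w : ℝ × EuclideanSpace ℝ (Fin 3) => g w.2 := hg.measurable.comp measurable_snd
  exact Measurable.ite (measurableSet_lt measurable_const measurable_fst) h1 h2

/-! ## The slice structure of a bootstrap level -/

set_option maxHeartbeats 20000000 in
/-- **Slice structure of a bootstrap level.** Fix the level `n`, the Hölder exponent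
`0 < γ < 1`, radii `0 < ρ₃ < ρ ≤ 7/25`, the velocity bound `K_b ≥ 0`, the uniformly local energy
`α_u`, datum bounds `A_d` and the level-`n` constant `𝒞`. There is `𝒱` such that: for every local
Leray solution `(u, p)` (measurable datum `u₀`, smooth on `B(x₀,1)` with `‖Dᵏu₀‖ ≤ A_d k` there),
times `0 < T_b < T_b' ≤ T'`, `T_b' ≤ 1`, `|u| ≤ K_b` a.e. on `(0,T_b') × B(x₀,7/12)`, uniformly local
energy `≤ α_u`, and every level-`n` representative `R` (jointly strongly measurable, `Cⁿ` slices with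
`‖DᵏR(t)‖ ≤ 𝒞`, `[DⁿR(t)]_γ ≤ 𝒞`, `R(t) = u(t)` a.e. on `B(x₀,ρ)` for a.e. `t < T_b`), there are
`V : Fin 3 → ℝ → ℝ³ → ℝ` (jointly measurable, `C^{n+1}` slices with `‖DᵐV_k(t)‖ ≤ 𝒱`,
`[Dⁿ⁺¹V_k(t)]_γ ≤ 𝒱`) and `Q : ℝ → ℝ³ → ℝ` (jointly measurable, `∫ |Q(t)| ≤ 𝒱`) with, for a.e.
`t ∈ (0,T_b)`: for every test function `φ` supported in `B(x₀,ρ₃)` and every `k`,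
`∫ u_k(t) φ = ∫ V_k(t) φ + ∫ Q(t) ∂_kφ`; moreover `u(t)` is weakly divergence free and locally
integrable. (`V_k` collects the smooth pieces of the localised Duhamel formula of level `n` — the
shell terms smoothed off the diagonal, the caloric term, and the `x`-derivatives of the Duhamel
integrals of the inner data `χ RᵢR_k`, which gain a derivative; `Q = W₊⊛(χp)` is the pressure
potential, entering as a pure gradient.) [cite: JiaSverak2014, §3 proof of Thm. 3.2 (arXiv p. 9)] -/
theorem exists_slice_structure (n : ℕ) {γ : ℝ} (hγ0 : 0 < γ) (hγ1 : γ < 1) {ρ₃ ρ : ℝ} (hρ₃ : 0 < ρ₃)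
    (hρ₃ρ : ρ₃ < ρ) (hρ : ρ ≤ 7 / 25) {Kb : ℝ} (hKb : 0 ≤ Kb) (αu : ℝ≥0) {Ad : ℕ → ℝ} (hAd0 : ∀ k, 0 ≤ Ad k)
    {𝒞 : ℝ} (h𝒞 : 0 ≤ 𝒞) :
    ∃ 𝒱 : ℝ, 0 ≤ 𝒱 ∧ ∀ {T' : ℝ} {x₀ : EuclideanSpace ℝ (Fin 3)}
      {u₀ : (EuclideanSpace ℝ (Fin 3)) → (EuclideanSpace ℝ (Fin 3))}
      {u : ℝ → (EuclideanSpace ℝ (Fin 3)) → (EuclideanSpace ℝ (Fin 3))} {p : ℝ → (EuclideanSpace ℝ (Fin 3)) → ℝ}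
      {Tb Tb' : ℝ},
      AEStronglyMeasurable u₀ volume → IsLocalLeraySolutionOn T' 1 u₀ u p →
      0 < Tb → Tb < Tb' → Tb' ≤ T' → Tb' ≤ 1 →
      ContDiffOn ℝ (⊤ : ℕ∞) u₀ (ball x₀ 1) →
      (∀ k, ∀ x ∈ ball x₀ 1, ‖iteratedFDeriv ℝ k u₀ x‖ ≤ Ad k) →
      (∀ᵐ z ∂(volume.restrict (Ioo 0 Tb' ×ˢ ball x₀ (7 / 12))), ‖u z.1 z.2‖ ≤ Kb) →
      (∀ᵐ t ∂(volume.restrict (Ioo 0 T')), ∀ z : EuclideanSpace ℝ (Fin 3), ∫⁻ x in ball z 1, ‖u t x‖ₑ ^ 2 ≤ αu) →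
      ∀ (R : ℝ → (EuclideanSpace ℝ (Fin 3)) → (EuclideanSpace ℝ (Fin 3))),
      StronglyMeasurable (uncurry R) → (∀ t, ContDiff ℝ n (R t)) →
      (∀ t, ∀ k ≤ n, ∀ x, ‖iteratedFDeriv ℝ k (R t) x‖ ≤ 𝒞) →
      (∀ t x y, ‖iteratedFDeriv ℝ n (R t) x - iteratedFDeriv ℝ n (R t) y‖ ≤ 𝒞 * ‖x - y‖ ^ γ) →
      (∀ᵐ t ∂(volume.restrict (Ioo 0 Tb)), ∀ᵐ x ∂(volume.restrict (ball x₀ ρ)), R t x = u t x) →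
      ∃ (V : Fin 3 → ℝ → (EuclideanSpace ℝ (Fin 3)) → ℝ) (Q : ℝ → (EuclideanSpace ℝ (Fin 3)) → ℝ),
        (∀ k, StronglyMeasurable (uncurry (V k))) ∧
        (∀ k t, ContDiff ℝ (n + 1) (V k t)) ∧
        (∀ k t, ∀ m ≤ n + 1, ∀ x, ‖iteratedFDeriv ℝ m (V k t) x‖ ≤ 𝒱) ∧
        (∀ k t x y, ‖iteratedFDeriv ℝ (n + 1) (V k t) x - iteratedFDeriv ℝ (n + 1) (V k t) y‖ ≤ 𝒱 * ‖x - y‖ ^ γ) ∧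
        Measurable (uncurry Q) ∧ (∀ t, Integrable (Q t) volume) ∧ (∀ t, ∫ x, ‖Q t x‖ ≤ 𝒱) ∧
        ∀ᵐ t ∂(volume.restrict (Ioo 0 Tb)),
          (∀ φ : (EuclideanSpace ℝ (Fin 3)) → ℝ,
            FunctionSpaces.IsTestFunctionOn (⟨ball x₀ ρ₃, isOpen_ball⟩ : Opens (EuclideanSpace ℝ (Fin 3))) φ →
            ∀ k : Fin 3, ∫ x, ⟪u t x, EuclideanSpace.basisFun (Fin 3) ℝ k⟫ * φ x =
              (∫ x, V k t x * φ x) + ∫ x, Q t x * fderiv ℝ φ x (EuclideanSpace.basisFun (Fin 3) ℝ k)) ∧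
          IsWeaklyDivFree (u t) ∧ LocallyIntegrable (u t) volume := by
  classical
  set b : OrthonormalBasis (Fin 3) ℝ (EuclideanSpace ℝ (Fin 3)) := EuclideanSpace.basisFun (Fin 3) ℝ with hb_def
  have hb1 : ∀ i, ‖b i‖ = 1 := fun i => b.orthonormal.1 i
  /- ## universal objects: radii, cut-off, constants -/
  set d : ℝ := (ρ - ρ₃) / 3 with hd
  have hd0 : 0 < d := by rw [hd]; linarith
  have hd2 : d ≤ 2 := by rw [hd]; linarith
  set ρ₂ : ℝ := ρ₃ + d with hρ₂
  set ρ₁ : ℝ := ρ₃ + 2 * d with hρ₁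
  have hρ₃₂ : ρ₃ < ρ₂ := by rw [hρ₂]; linarith
  have hρ₂₁ : ρ₂ < ρ₁ := by rw [hρ₂, hρ₁]; linarith
  have hρ₁ρ : ρ₁ < ρ := by rw [hρ₁, hd]; linarith
  have hρ₁1 : ρ₁ < 1 := by linarith
  -- the model cut-off at the origin
  set χ₀ : ContDiffBump (0 : EuclideanSpace ℝ (Fin 3)) := ⟨ρ₂, ρ₁, hρ₃.trans hρ₃₂, hρ₂₁⟩ with hχ₀def
  have hχ₀s : ContDiff ℝ (⊤ : ℕ∞) χ₀ := χ₀.contDiff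
  have hχ₀supp : tsupport (χ₀ : EuclideanSpace ℝ (Fin 3) → ℝ) = closedBall 0 ρ₁ := χ₀.tsupport_eq
  have hχ₀cs : HasCompactSupport (χ₀ : EuclideanSpace ℝ (Fin 3) → ℝ) := χ₀.hasCompactSupport
  have hχ₀one : ∀ y ∈ closedBall (0 : EuclideanSpace ℝ (Fin 3)) ρ₂, χ₀ y = 1 := fun y hy => χ₀.one_of_mem_closedBall hy
  have hχ₀nn : ∀ y, 0 ≤ χ₀ y := fun y => χ₀.nonneg
  have hχ₀le : ∀ y, χ₀ y ≤ 1 := fun y => χ₀.le_one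
  -- bounds of all derivatives of the model cut-off
  have hXex : ∀ m : ℕ, ∃ Xm : ℝ, ∀ y, ‖iteratedFDeriv ℝ m (χ₀ : EuclideanSpace ℝ (Fin 3) → ℝ) y‖ ≤ Xm := fun m =>
    (hχ₀cs.iteratedFDeriv (𝕜 := ℝ) m).exists_bound_of_continuous (hχ₀s.continuous_iteratedFDeriv (by exact_mod_cast le_top))
  choose X' hX' using hXex
  set X : ℕ → ℝ := fun m => max (X' m) 0 with hXdef
  have hX0 : ∀ m, 0 ≤ X m := fun m => le_max_right _ _
  have hX : ∀ m y, ‖iteratedFDeriv ℝ m (χ₀ : EuclideanSpace ℝ (Fin 3) → ℝ) y‖ ≤ X m := fun m y =>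
    (hX' m y).trans (le_max_left _ _)
  -- sums of the first bounds
  set Xn : ℝ := ∑ m ∈ Finset.range (n + 4), X m with hXn
  have hXn0 : 0 ≤ Xn := Finset.sum_nonneg fun m _ => hX0 m
  have hXle : ∀ m ≤ n + 3, X m ≤ Xn := fun m hm =>
    Finset.single_le_sum (fun i _ => hX0 i) (Finset.mem_range.2 (by omega))
  -- the constants of the tools
  obtain ⟨Pp, hPp0, hLD⟩ := exists_localised_data hKb αu
  obtain ⟨Moff, hMoff⟩ := OffDiagHeat.exists_offDiagonal_smoothing (E := EuclideanSpace ℝ (Fin 3)) hd0 hd2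
  obtain ⟨Ce, hCe0, hCe⟩ := HeatHolder.exists_duhamel_level_bounds (E := EuclideanSpace ℝ (Fin 3)) n hγ0 hγ1
  obtain ⟨Kd, hKd0, hKd⟩ := exists_inner_data_bounds n
  -- nonnegative versions of the off-diagonal constants
  set Mo : ℕ → ℝ := fun m => max (Moff m) 0 with hMo
  have hMo0 : ∀ m, 0 ≤ Mo m := fun m => le_max_right _ _
  set Mon : ℝ := ∑ m ∈ Finset.range (n + 4), Mo m with hMon
  have hMon0 : 0 ≤ Mon := Finset.sum_nonneg fun m _ => hMo0 m
  have hMole : ∀ m ≤ n + 3, Mo m ≤ Mon := fun m hm =>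
    Finset.single_le_sum (fun i _ => hMo0 i) (Finset.mem_range.2 (by omega))
  -- data constant of the inner terms
  set Md : ℝ := Kd * (2 * Xn + Kd * 𝒞 ^ 2) ^ 2 with hMd
  have hMd0 : 0 ≤ Md := by rw [hMd]; positivity
  -- caloric data bounds
  set Bc : ℕ → ℝ := fun m => ∑ i ∈ Finset.range (m + 1), (m.choose i : ℝ) * X i * Ad (m - i) with hBc
  have hBc0 : ∀ m, 0 ≤ Bc m := fun m => Finset.sum_nonneg fun i _ => by
    have := hX0 i; have := hAd0 (m - i); positivity
  set Bn : ℝ := ∑ m ∈ Finset.range (n + 4), Bc m with hBn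
  have hBn0 : 0 ≤ Bn := Finset.sum_nonneg fun m _ => hBc0 m
  have hBle : ∀ m ≤ n + 3, Bc m ≤ Bn := fun m hm =>
    Finset.single_le_sum (fun i _ => hBc0 i) (Finset.mem_range.2 (by omega))
  -- `L¹` sizes of the data
  set V1 : ℝ := (volume : Measure (EuclideanSpace ℝ (Fin 3))).real (ball 0 1) with hV1
  have hV10 : 0 ≤ V1 := by rw [hV1]; exact measureReal_nonneg
  set L₁ : ℝ := 3 * Xn * Kb * V1 + 2 * Xn * Kb * V1 + Xn * Kb ^ 2 * V1 + Xn * Pp with hL₁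
  have hL₁0 : 0 ≤ L₁ := by rw [hL₁]; positivity
  -- the level constant
  set 𝒱 : ℝ := 16 * (Mon * L₁ + Bn + Ce * Md + Xn * Pp) + 1 with h𝒱
  have h𝒱0 : 0 ≤ 𝒱 := by rw [h𝒱]; positivity
  refine ⟨𝒱, h𝒱0, ?_⟩
  intro T' x₀ u₀ u p Tb Tb' hm₀ hu hTb hTbTb' hTb'T' hTb1 hu₀s hAd hbd hαu R hRm hRn hRb hRH hRu
  have hTb' : 0 < Tb' := hTb.trans hTbTb'
  have hT' : 0 < T' := hTb'.trans_le hTb'T'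
  have hTb1' : Tb ≤ 1 := hTbTb'.le.trans hTb1
  /- ## the cut-off at `x₀` -/
  set χ : (EuclideanSpace ℝ (Fin 3)) → ℝ := fun x => χ₀ (x - x₀) with hχdef
  have hχs : ContDiff ℝ (⊤ : ℕ∞) χ := hχ₀s.comp (contDiff_id.sub contDiff_const)
  have hχD : ∀ m y, iteratedFDeriv ℝ m χ y = iteratedFDeriv ℝ m (χ₀ : EuclideanSpace ℝ (Fin 3) → ℝ) (y - x₀) :=
    fun m y => iteratedFDeriv_comp_sub m x₀ y
  have hχX : ∀ m y, ‖iteratedFDeriv ℝ m χ y‖ ≤ X m := fun m y => by rw [hχD]; exact hX m _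
  have hχsupp : tsupport χ ⊆ closedBall x₀ ρ₁ := by
    refine closure_minimal (fun y hy => ?_) isClosed_closedBall
    have h1 : y - x₀ ∈ tsupport (χ₀ : EuclideanSpace ℝ (Fin 3) → ℝ) := subset_tsupport _ (by simpa [hχdef] using hy)
    rw [hχ₀supp, mem_closedBall, dist_zero_right] at h1
    rwa [mem_closedBall, dist_eq_norm]
  have hχone : ∀ y ∈ closedBall x₀ ρ₂, χ y = 1 := fun y hy => by
    simp only [hχdef]
    exact hχ₀one _ (by rw [mem_closedBall, dist_zero_right]; rwa [mem_closedBall, dist_eq_norm] at hy)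
  have hχzero : ∀ y, y ∉ closedBall x₀ ρ₁ → χ y = 0 := fun y hy =>
    image_eq_zero_of_notMem_tsupport fun h => hy (hχsupp h)
  have hχsupp' : tsupport χ ⊆ closedBall x₀ (7 / 25) := hχsupp.trans (closedBall_subset_closedBall (by linarith))
  have hχabs : ∀ y, |χ y| ≤ 1 := fun y => by
    rw [abs_of_nonneg (hχ₀nn _)]; exact hχ₀le _
  have hχfd : ∀ y v, |fderiv ℝ χ y v| ≤ X 1 * ‖v‖ := by
    intro y v
    calc |fderiv ℝ χ y v| = ‖fderiv ℝ χ y v‖ := (Real.norm_eq_abs _).symm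
      _ ≤ ‖fderiv ℝ χ y‖ * ‖v‖ := ContinuousLinearMap.le_opNorm _ _
      _ ≤ X 1 * ‖v‖ := by
          refine mul_le_mul_of_nonneg_right ?_ (norm_nonneg _)
          rw [← norm_iteratedFDeriv_one (𝕜 := ℝ)]
          exact hχX 1 y
  have hχΔ : ∀ y, |(Δ χ) y| ≤ 3 * X 2 := by
    intro y
    have h := HeatHolder.norm_laplacian_le (E := EuclideanSpace ℝ (Fin 3)) χ y
    rw [finrank_euclideanSpace_fin, Real.norm_eq_abs] at h
    calc |(Δ χ) y| ≤ (3 : ℕ) * ‖iteratedFDeriv ℝ 2 χ y‖ := h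
      _ ≤ 3 * X 2 := by push_cast; exact mul_le_mul_of_nonneg_left (hχX 2 y) (by norm_num)
  /- ## the localised data -/
  have hu₀M : ∀ x ∈ closedBall x₀ (7 / 25), ‖u₀ x‖ ≤ Ad 0 := fun x hx => by
    have h := hAd 0 x (closedBall_subset_ball (by norm_num) hx)
    rwa [norm_iteratedFDeriv_zero] at h
  obtain ⟨us, ps, pb, husm, hpbm, hus, hus0, husb, husi, hus2, hps0, hpsi, hpspb, hpb0, hpbI, hpbL1, hrep⟩ :=
    hLD hm₀ hu hTb hTbTb' hTb'T' hTb1 hu₀M hbd hαu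
  set S : Set (ℝ × EuclideanSpace ℝ (Fin 3)) := Ioo 0 Tb' ×ˢ (univ : Set (EuclideanSpace ℝ (Fin 3))) with hS
  /- ## the compact carrier of the truncated data and a generic integrability lemma -/
  set K : Set (ℝ × EuclideanSpace ℝ (Fin 3)) := Icc 0 Tb ×ˢ closedBall x₀ ρ₁ with hK
  have hKm : MeasurableSet K := measurableSet_Icc.prod measurableSet_closedBall
  have hcbB : closedBall x₀ ρ₁ ⊆ ball x₀ 1 := closedBall_subset_ball hρ₁1
  have hcb712 : closedBall x₀ ρ₁ ⊆ ball x₀ (7 / 12) := closedBall_subset_ball (by linarith)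
  have hcb724 : closedBall x₀ ρ₁ ⊆ ball x₀ (7 / 24) := closedBall_subset_ball (by linarith)
  have hKvol : (volume : Measure (ℝ × EuclideanSpace ℝ (Fin 3))).real K ≤ V1 := by
    rw [hK, measureReal_def, Measure.volume_eq_prod, Measure.prod_prod, Real.volume_Icc, sub_zero, hV1, measureReal_def]
    have h1 : (volume : Measure (EuclideanSpace ℝ (Fin 3))) (closedBall x₀ ρ₁) ≤ volume (ball (0 : EuclideanSpace ℝ (Fin 3)) 1) := by
      rw [← Measure.addHaar_ball_center volume x₀ 1]; exact measure_mono hcbB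
    have h2 : ENNReal.ofReal Tb * (volume : Measure (EuclideanSpace ℝ (Fin 3))) (closedBall x₀ ρ₁) ≤
        1 * volume (ball (0 : EuclideanSpace ℝ (Fin 3)) 1) := mul_le_mul' (ENNReal.ofReal_le_one.2 hTb1') h1
    rw [one_mul] at h2
    exact ENNReal.toReal_mono measure_ball_lt_top.ne h2
  have hKfin : (volume : Measure (ℝ × EuclideanSpace ℝ (Fin 3))) K ≠ ⊤ := by
    rw [hK, Measure.volume_eq_prod, Measure.prod_prod]
    exact ENNReal.mul_ne_top measure_Icc_lt_top.ne measure_closedBall_lt_top.ne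
  have hbdint : ∀ {D : ℝ × EuclideanSpace ℝ (Fin 3) → ℝ}, Measurable D → (∀ w, w ∉ K → D w = 0) → ∀ {C : ℝ}, 0 ≤ C →
      (∀ w, |D w| ≤ C) → Integrable D volume ∧ ∫ w, ‖D w‖ ≤ C * V1 := by
    intro D hDm hDK C hC0 hDC
    have hi : IntegrableOn D K volume :=
      Measure.integrableOn_of_bounded hKfin hDm.aestronglyMeasurable (Eventually.of_forall fun w => by
        rw [Real.norm_eq_abs]; exact hDC w)
    have hI : Integrable D volume := hi.integrable_of_forall_notMem_eq_zero hDK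
    refine ⟨hI, ?_⟩
    have e1 : ∫ w, ‖D w‖ = ∫ w in K, ‖D w‖ := (setIntegral_eq_integral_of_forall_compl_eq_zero fun w hw => by
      rw [hDK w hw, norm_zero]).symm
    rw [e1]
    calc ∫ w in K, ‖D w‖ ≤ ∫ _w in K, C := by
          refine setIntegral_mono_on hI.norm.integrableOn (integrableOn_const hKfin) hKm fun w _ => ?_
          rw [Real.norm_eq_abs]; exact hDC w
      _ = C * (volume : Measure (ℝ × EuclideanSpace ℝ (Fin 3))).real K := by rw [setIntegral_const, smul_eq_mul, mul_comm]
      _ ≤ C * V1 := mul_le_mul_of_nonneg_left hKvol hC0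
  -- membership in `K` from the factors
  have hKof : ∀ w : ℝ × EuclideanSpace ℝ (Fin 3), w.1 < Tb → w ∈ S → w.2 ∈ closedBall x₀ ρ₁ → w ∈ K := fun w h1 h2 h3 =>
    ⟨⟨h2.1.1.le, h1.le⟩, h3⟩
  /- ## the data -/
  -- components of the modified velocity are bounded by `K_b` over the carrier
  have husK : ∀ w : ℝ × EuclideanSpace ℝ (Fin 3), w.2 ∈ closedBall x₀ ρ₁ → ∀ v, ‖v‖ ≤ 1 → |⟪us w, v⟫| ≤ Kb := by
    intro w hw v hv
    calc |⟪us w, v⟫| ≤ ‖us w‖ * ‖v‖ := abs_real_inner_le_norm _ _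
      _ ≤ Kb * 1 := mul_le_mul (husb w (hcb712 hw)) hv (norm_nonneg _) hKb
      _ = Kb := mul_one _
  have hRK : ∀ (s : ℝ) (y v : EuclideanSpace ℝ (Fin 3)), ‖v‖ ≤ 1 → |⟪R s y, v⟫| ≤ 𝒞 := by
    intro s y v hv
    have h0 : ‖R s y‖ ≤ 𝒞 := by have := hRb s 0 (Nat.zero_le _) y; rwa [norm_iteratedFDeriv_zero] at this
    calc |⟪R s y, v⟫| ≤ ‖R s y‖ * ‖v‖ := abs_real_inner_le_norm _ _
      _ ≤ 𝒞 * 1 := mul_le_mul h0 hv (norm_nonneg _) h𝒞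
      _ = 𝒞 := mul_one _
  -- measurability of the building blocks
  have hmχ : Measurable fun w : ℝ × EuclideanSpace ℝ (Fin 3) => χ w.2 := hχs.continuous.measurable.comp measurable_snd
  have hmfdχ : ∀ v, Measurable fun w : ℝ × EuclideanSpace ℝ (Fin 3) => fderiv ℝ χ w.2 v := fun v =>
    ((hχs.continuous_fderiv (by simp)).clm_apply continuous_const).measurable.comp measurable_snd
  have hmΔχ : Measurable fun w : ℝ × EuclideanSpace ℝ (Fin 3) => (Δ χ) w.2 :=
    (continuous_laplacian (hχs.of_le (by norm_cast) : ContDiff ℝ 2 χ)).measurable.comp measurable_snd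
  have hmusc : ∀ v, Measurable fun w : ℝ × EuclideanSpace ℝ (Fin 3) => ⟪us w, v⟫ := fun v =>
    husm.inner measurable_const
  have hmRc : ∀ v, Measurable fun w : ℝ × EuclideanSpace ℝ (Fin 3) => ⟪R w.1 w.2, v⟫ := fun v =>
    (hRm.measurable : Measurable (uncurry R)).inner measurable_const
  have hmT : MeasurableSet {w : ℝ × EuclideanSpace ℝ (Fin 3) | w.1 < Tb} := measurableSet_lt measurable_fst measurable_const
  have hmI : MeasurableSet {w : ℝ × EuclideanSpace ℝ (Fin 3) | w.1 ∈ Ioo 0 Tb} := measurable_fst measurableSet_Ioo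
  -- D1, D2, D3 (shell terms, with `us`), D4' (inner term, with `R`), D5, D6 (pressure terms)
  set D1 : Fin 3 → ℝ × EuclideanSpace ℝ (Fin 3) → ℝ := fun k w =>
    if w.1 < Tb then (Δ χ) w.2 * ⟪us w, b k⟫ else 0 with hD1
  set D2 : Fin 3 → Fin 3 → ℝ × EuclideanSpace ℝ (Fin 3) → ℝ := fun k i w =>
    if w.1 < Tb then (2 * fderiv ℝ χ w.2 (b i)) * ⟪us w, b k⟫ else 0 with hD2
  set D3 : Fin 3 → Fin 3 → ℝ × EuclideanSpace ℝ (Fin 3) → ℝ := fun k i w =>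
    if w.1 < Tb then fderiv ℝ χ w.2 (b i) * (⟪us w, b i⟫ * ⟪us w, b k⟫) else 0 with hD3
  set D4 : Fin 3 → Fin 3 → ℝ × EuclideanSpace ℝ (Fin 3) → ℝ := fun k i w =>
    if w.1 < Tb then χ w.2 * (⟪us w, b i⟫ * ⟪us w, b k⟫) else 0 with hD4
  set g4 : Fin 3 → Fin 3 → ℝ → (EuclideanSpace ℝ (Fin 3)) → ℝ := fun k i s y =>
    if s ∈ Ioo 0 Tb then χ y * (⟪R s y, b i⟫ * ⟪R s y, b k⟫) else 0 with hg4
  set D4' : Fin 3 → Fin 3 → ℝ × EuclideanSpace ℝ (Fin 3) → ℝ := fun k i w => g4 k i w.1 w.2 with hD4'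
  set D5 : Fin 3 → ℝ × EuclideanSpace ℝ (Fin 3) → ℝ := fun k w =>
    if w.1 < Tb then fderiv ℝ χ w.2 (b k) * pb w else 0 with hD5
  set D6 : ℝ × EuclideanSpace ℝ (Fin 3) → ℝ := fun w => if w.1 < Tb then χ w.2 * pb w else 0 with hD6
  -- measurability
  have hD1m : ∀ k, Measurable (D1 k) := fun k => Measurable.ite hmT (hmΔχ.mul (hmusc _)) measurable_const
  have hD2m : ∀ k i, Measurable (D2 k i) := fun k i =>
    Measurable.ite hmT ((measurable_const.mul (hmfdχ _)).mul (hmusc _)) measurable_const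
  have hD3m : ∀ k i, Measurable (D3 k i) := fun k i =>
    Measurable.ite hmT ((hmfdχ _).mul ((hmusc _).mul (hmusc _))) measurable_const
  have hD4m : ∀ k i, Measurable (D4 k i) := fun k i =>
    Measurable.ite hmT (hmχ.mul ((hmusc _).mul (hmusc _))) measurable_const
  have hg4m : ∀ k i, Measurable (uncurry (g4 k i)) := fun k i => by
    have : uncurry (g4 k i) = fun w : ℝ × EuclideanSpace ℝ (Fin 3) =>
        if w.1 ∈ Ioo 0 Tb then χ w.2 * (⟪R w.1 w.2, b i⟫ * ⟪R w.1 w.2, b k⟫) else 0 := by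
      funext w; rfl
    rw [this]
    exact Measurable.ite hmI (hmχ.mul ((hmRc _).mul (hmRc _))) measurable_const
  have hD4'm : ∀ k i, Measurable (D4' k i) := fun k i => hg4m k i
  have hD5m : ∀ k, Measurable (D5 k) := fun k => Measurable.ite hmT ((hmfdχ _).mul hpbm) measurable_const
  have hD6m : Measurable D6 := Measurable.ite hmT (hmχ.mul hpbm) measurable_const
  -- vanishing off the carrier `K`
  have hχfdzero : ∀ y, y ∉ closedBall x₀ ρ₁ → ∀ v, fderiv ℝ χ y v = 0 := fun y hy v => by
    have h0 : χ =ᶠ[𝓝 y] fun _ => (0 : ℝ) := notMem_tsupport_iff_eventuallyEq.1 fun h => hy (hχsupp h)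
    rw [h0.fderiv_eq, fderiv_fun_const]; rfl
  have hχΔzero : ∀ y, y ∉ closedBall x₀ ρ₁ → (Δ χ) y = 0 := fun y hy =>
    laplacian_eq_zero_of_notMem_tsupport fun h => hy (hχsupp h)
  have hD1K : ∀ k w, w ∉ K → D1 k w = 0 := by
    intro k w hw
    simp only [hD1]
    split_ifs with h1
    · by_cases h2 : w ∈ S
      · have h3 : w.2 ∉ closedBall x₀ ρ₁ := fun h => hw (hKof w h1 h2 h)
        rw [hχΔzero _ h3, zero_mul]
      · rw [hus0 w h2, inner_zero_left, mul_zero]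
    · rfl
  have hD2K : ∀ k i w, w ∉ K → D2 k i w = 0 := by
    intro k i w hw
    simp only [hD2]
    split_ifs with h1
    · by_cases h2 : w ∈ S
      · have h3 : w.2 ∉ closedBall x₀ ρ₁ := fun h => hw (hKof w h1 h2 h)
        rw [hχfdzero _ h3, mul_zero, zero_mul]
      · rw [hus0 w h2, inner_zero_left, mul_zero]
    · rfl
  have hD3K : ∀ k i w, w ∉ K → D3 k i w = 0 := by
    intro k i w hw
    simp only [hD3]
    split_ifs with h1
    · by_cases h2 : w ∈ S
      · have h3 : w.2 ∉ closedBall x₀ ρ₁ := fun h => hw (hKof w h1 h2 h)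
        rw [hχfdzero _ h3, zero_mul]
      · rw [hus0 w h2, inner_zero_left, zero_mul, mul_zero]
    · rfl
  have hD4K : ∀ k i w, w ∉ K → D4 k i w = 0 := by
    intro k i w hw
    simp only [hD4]
    split_ifs with h1
    · by_cases h2 : w ∈ S
      · have h3 : w.2 ∉ closedBall x₀ ρ₁ := fun h => hw (hKof w h1 h2 h)
        rw [hχzero _ h3, zero_mul]
      · rw [hus0 w h2, inner_zero_left, zero_mul, mul_zero]
    · rfl
  have hg4K : ∀ k i w, w ∉ K → D4' k i w = 0 := by
    intro k i w hw
    simp only [hD4', hg4]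
    split_ifs with h1
    · have h3 : w.2 ∉ closedBall x₀ ρ₁ := fun h => hw ⟨⟨h1.1.le, h1.2.le⟩, h⟩
      rw [hχzero _ h3, zero_mul]
    · rfl
  have hD5K : ∀ k w, w ∉ K → D5 k w = 0 := by
    intro k w hw
    simp only [hD5]
    split_ifs with h1
    · by_cases h2 : w ∈ S
      · have h3 : w.2 ∉ closedBall x₀ ρ₁ := fun h => hw (hKof w h1 h2 h)
        rw [hχfdzero _ h3, zero_mul]
      · rw [hpb0 w h2, mul_zero]
    · rfl
  have hD6K : ∀ w, w ∉ K → D6 w = 0 := by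
    intro w hw
    simp only [hD6]
    split_ifs with h1
    · by_cases h2 : w ∈ S
      · have h3 : w.2 ∉ closedBall x₀ ρ₁ := fun h => hw (hKof w h1 h2 h)
        rw [hχzero _ h3, zero_mul]
      · rw [hpb0 w h2, mul_zero]
    · rfl
  -- time supports (consequence)
  have hKt : ∀ {D : ℝ × EuclideanSpace ℝ (Fin 3) → ℝ}, (∀ w, w ∉ K → D w = 0) → ∀ w, D w ≠ 0 → w.1 ∈ Icc (0 : ℝ) Tb :=
    fun hDK w hw => by by_contra h; exact hw (hDK w fun hK => h hK.1)
  have hKt1 : ∀ {D : ℝ × EuclideanSpace ℝ (Fin 3) → ℝ}, (∀ w, w ∉ K → D w = 0) → ∀ w, D w ≠ 0 → w.1 ∈ Icc (0 : ℝ) 1 :=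
    fun hDK w hw => by have h := hKt hDK w hw; exact ⟨h.1, h.2.trans hTb1'⟩
  have hKtae : ∀ {D : ℝ × EuclideanSpace ℝ (Fin 3) → ℝ}, (∀ w, w ∉ K → D w = 0) →
      ∀ᵐ w ∂(volume : Measure (ℝ × EuclideanSpace ℝ (Fin 3))), D w ≠ 0 → w.1 ∈ Icc (0 : ℝ) Tb :=
    fun hDK => Eventually.of_forall (hKt hDK)
  -- pointwise bounds of the bounded data
  have hD1b : ∀ k w, |D1 k w| ≤ 3 * Xn * Kb := by
    intro k w
    have h0 : (0 : ℝ) ≤ 3 * Xn * Kb := by positivity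
    by_cases hw : w ∈ K
    · simp only [hD1]
      split_ifs
      · rw [abs_mul]
        exact mul_le_mul ((hχΔ _).trans (by nlinarith [hXle 2 (by omega), hX0 2])) (husK w hw.2 _ (hb1 k).le)
          (abs_nonneg _) (by positivity)
      · simpa using h0
    · rw [hD1K k w hw, abs_zero]; exact h0
  have hD2b : ∀ k i w, |D2 k i w| ≤ 2 * Xn * Kb := by
    intro k i w
    have h0 : (0 : ℝ) ≤ 2 * Xn * Kb := by positivity
    by_cases hw : w ∈ K
    · simp only [hD2]
      split_ifs
      · rw [abs_mul, abs_mul, abs_two]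
        refine mul_le_mul ?_ (husK w hw.2 _ (hb1 k).le) (abs_nonneg _) (by positivity)
        have := hχfd w.2 (b i); rw [hb1, mul_one] at this
        nlinarith [hXle 1 (by omega), hX0 1, abs_nonneg (fderiv ℝ χ w.2 (b i))]
      · simpa using h0
    · rw [hD2K k i w hw, abs_zero]; exact h0
  have hD3b : ∀ k i w, |D3 k i w| ≤ Xn * Kb ^ 2 := by
    intro k i w
    have h0 : (0 : ℝ) ≤ Xn * Kb ^ 2 := by positivity
    by_cases hw : w ∈ K
    · simp only [hD3]
      split_ifs
      · rw [abs_mul, abs_mul]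
        have h1 := hχfd w.2 (b i); rw [hb1, mul_one] at h1
        have h2 := husK w hw.2 _ (hb1 i).le
        have h3 := husK w hw.2 _ (hb1 k).le
        calc |fderiv ℝ χ w.2 (b i)| * (|⟪us w, b i⟫| * |⟪us w, b k⟫|) ≤ Xn * (Kb * Kb) :=
              mul_le_mul (h1.trans (hXle 1 (by omega))) (mul_le_mul h2 h3 (abs_nonneg _) hKb)
                (by positivity) hXn0
          _ = Xn * Kb ^ 2 := by ring
      · simpa using h0
    · rw [hD3K k i w hw, abs_zero]; exact h0
  have hg4b : ∀ k i s y, |g4 k i s y| ≤ 𝒞 ^ 2 := by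
    intro k i s y
    simp only [hg4]
    split_ifs
    · rw [abs_mul, abs_mul]
      calc |χ y| * (|⟪R s y, b i⟫| * |⟪R s y, b k⟫|) ≤ 1 * (𝒞 * 𝒞) :=
            mul_le_mul (hχabs y) (mul_le_mul (hRK s y _ (hb1 i).le) (hRK s y _ (hb1 k).le) (abs_nonneg _) h𝒞)
              (by positivity) zero_le_one
        _ = 𝒞 ^ 2 := by ring
    · simpa using sq_nonneg 𝒞
  have hD4'b : ∀ k i w, |D4' k i w| ≤ 𝒞 ^ 2 := fun k i w => hg4b k i w.1 w.2
  -- integrability and `L¹` sizes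
  have hD1i : ∀ k, Integrable (D1 k) volume ∧ ∫ w, ‖D1 k w‖ ≤ 3 * Xn * Kb * V1 := fun k =>
    hbdint (hD1m k) (hD1K k) (by positivity) (hD1b k)
  have hD2i : ∀ k i, Integrable (D2 k i) volume ∧ ∫ w, ‖D2 k i w‖ ≤ 2 * Xn * Kb * V1 := fun k i =>
    hbdint (hD2m k i) (hD2K k i) (by positivity) (hD2b k i)
  have hD3i : ∀ k i, Integrable (D3 k i) volume ∧ ∫ w, ‖D3 k i w‖ ≤ Xn * Kb ^ 2 * V1 := fun k i =>
    hbdint (hD3m k i) (hD3K k i) (by positivity) (hD3b k i)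
  have hD4'i : ∀ k i, Integrable (D4' k i) volume := fun k i => (hbdint (hD4'm k i) (hg4K k i) (sq_nonneg 𝒞) (hD4'b k i)).1
  -- the pressure data: dominated by `X |pb|` on the cylinder
  have hcylI : ∀ {X1 : ℝ}, 0 ≤ X1 → ∀ {D : ℝ × EuclideanSpace ℝ (Fin 3) → ℝ}, Measurable D →
      (∀ w, |D w| ≤ X1 * ‖(Ioo 0 Tb' ×ˢ ball x₀ (7 / 24)).indicator pb w‖) →
      Integrable D volume ∧ ∫ w, ‖D w‖ ≤ X1 * Pp := by
    intro X1 hX1 D hDm hDle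
    have hmaj : Integrable (fun w => X1 * ‖(Ioo 0 Tb' ×ˢ ball x₀ (7 / 24)).indicator pb w‖) volume := by
      have h1 : Integrable ((Ioo 0 Tb' ×ˢ ball x₀ (7 / 24)).indicator pb) volume :=
        (integrable_indicator_iff (measurableSet_Ioo.prod measurableSet_ball)).2 hpbI
      exact h1.norm.const_mul X1
    have hI : Integrable D volume := hmaj.mono' hDm.aestronglyMeasurable (Eventually.of_forall fun w => by
      rw [Real.norm_eq_abs]; exact hDle w)
    refine ⟨hI, ?_⟩
    calc ∫ w, ‖D w‖ ≤ ∫ w, X1 * ‖(Ioo 0 Tb' ×ˢ ball x₀ (7 / 24)).indicator pb w‖ :=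
          integral_mono hI.norm hmaj fun w => by rw [Real.norm_eq_abs]; exact hDle w
      _ = X1 * ∫ w, ‖(Ioo 0 Tb' ×ˢ ball x₀ (7 / 24)).indicator pb w‖ := integral_const_mul _ _
      _ = X1 * ∫ w in Ioo 0 Tb' ×ˢ ball x₀ (7 / 24), ‖pb w‖ := by
          congr 1
          rw [← integral_indicator (measurableSet_Ioo.prod measurableSet_ball)]
          refine integral_congr_ae (Eventually.of_forall fun w => ?_)
          simp only [indicator]
          split_ifs <;> simp
      _ ≤ X1 * Pp := mul_le_mul_of_nonneg_left hpbL1 hX1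
  have hpbcyl : ∀ w : ℝ × EuclideanSpace ℝ (Fin 3), w.1 < Tb → ∀ {a : ℝ}, (w.2 ∉ closedBall x₀ ρ₁ → a = 0) → ∀ {X1 : ℝ}, |a| ≤ X1 →
      |a * pb w| ≤ X1 * ‖(Ioo 0 Tb' ×ˢ ball x₀ (7 / 24)).indicator pb w‖ := by
    intro w hw a ha X1 haX
    have hX1 : 0 ≤ X1 := (abs_nonneg _).trans haX
    by_cases h2 : w ∈ S
    · by_cases h3 : w.2 ∈ closedBall x₀ ρ₁
      · have hmem : w ∈ Ioo 0 Tb' ×ˢ ball x₀ (7 / 24) := ⟨h2.1, hcb724 h3⟩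
        rw [indicator_of_mem hmem, abs_mul, Real.norm_eq_abs]
        exact mul_le_mul_of_nonneg_right haX (abs_nonneg _)
      · rw [ha h3, zero_mul, abs_zero]; positivity
    · rw [hpb0 w h2, mul_zero, abs_zero]; positivity
  have hD5i : ∀ k, Integrable (D5 k) volume ∧ ∫ w, ‖D5 k w‖ ≤ Xn * Pp := by
    intro k
    refine hcylI hXn0 (hD5m k) fun w => ?_
    simp only [hD5]
    split_ifs with h1
    · refine hpbcyl w h1 (fun h3 => hχfdzero _ h3 _) ?_
      have := hχfd w.2 (b k); rw [hb1, mul_one] at this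
      exact this.trans (hXle 1 (by omega))
    · rw [abs_zero]; positivity
  have hD6i : Integrable D6 volume ∧ ∫ w, ‖D6 w‖ ≤ Xn * Pp := by
    refine hcylI hXn0 hD6m fun w => ?_
    simp only [hD6]
    split_ifs with h1
    · refine hpbcyl w h1 (fun h3 => hχzero _ h3) ((hχabs _).trans ?_)
      have h := hXle 0 (by omega)
      have h' : (1 : ℝ) ≤ X 0 := by
        have := hX 0 0
        rw [norm_iteratedFDeriv_zero] at this
        have h1' : ‖(χ₀ : EuclideanSpace ℝ (Fin 3) → ℝ) 0‖ = 1 := by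
          rw [Real.norm_eq_abs, abs_of_nonneg (hχ₀nn 0), hχ₀one 0 (mem_closedBall_self (by linarith))]
        linarith
      linarith
    · rw [abs_zero]; positivity
  /- ## separation of the shell data from the inner ball -/
  have hχnear1 : ∀ y ∈ ball x₀ ρ₂, χ =ᶠ[𝓝 y] fun _ => (1 : ℝ) := fun y hy =>
    mem_of_superset (isOpen_ball.mem_nhds hy) fun z hz => hχone z (ball_subset_closedBall hz)
  have hχfd_in : ∀ y ∈ ball x₀ ρ₂, ∀ v, fderiv ℝ χ y v = 0 := fun y hy v => by
    rw [(hχnear1 y hy).fderiv_eq, fderiv_fun_const]; rfl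
  have hχΔ_in : ∀ y ∈ ball x₀ ρ₂, (Δ χ) y = 0 := fun y hy => by
    have h := HeatHolder.norm_laplacian_le (E := EuclideanSpace ℝ (Fin 3)) χ y
    have h2 : iteratedFDeriv ℝ 2 χ y = 0 := by
      rw [((hχnear1 y hy).iteratedFDeriv (𝕜 := ℝ) 2).eq_of_nhds, iteratedFDeriv_const_of_ne (by norm_num)]
      rfl
    rw [h2, norm_zero, mul_zero] at h
    exact norm_le_zero_iff.1 h
  -- separation predicate for a datum vanishing unless `w.2 ∈ closedBall x₀ ρ₁ \ ball x₀ ρ₂`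
  have hsep_of : ∀ {D : ℝ × EuclideanSpace ℝ (Fin 3) → ℝ},
      (∀ w, D w ≠ 0 → w.2 ∈ closedBall x₀ ρ₁ ∧ w.2 ∉ ball x₀ ρ₂) →
      ∀ x ∈ ball x₀ ρ₃, ∀ w, D w ≠ 0 → d ≤ ‖x - w.2‖ ∧ ‖x - w.2‖ ≤ 2 := by
    intro D hD x hx w hw
    obtain ⟨h1, h2⟩ := hD w hw
    rw [mem_closedBall, dist_eq_norm] at h1
    rw [mem_ball, dist_eq_norm, not_lt] at h2
    rw [mem_ball, dist_eq_norm] at hx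
    constructor
    · have : ‖w.2 - x₀‖ ≤ ‖x - w.2‖ + ‖x - x₀‖ := by
        calc ‖w.2 - x₀‖ = ‖(x - x₀) - (x - w.2)‖ := by congr 1; abel
          _ ≤ ‖x - x₀‖ + ‖x - w.2‖ := norm_sub_le _ _
          _ = _ := add_comm _ _
      rw [hρ₂] at h2; linarith
    · calc ‖x - w.2‖ = ‖(x - x₀) - (w.2 - x₀)‖ := by congr 1; abel
        _ ≤ ‖x - x₀‖ + ‖w.2 - x₀‖ := norm_sub_le _ _
        _ ≤ 2 := by linarith
  -- the shell data satisfy it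
  have hshell_fd : ∀ (w : ℝ × EuclideanSpace ℝ (Fin 3)) (v : EuclideanSpace ℝ (Fin 3)) (a : ℝ),
      fderiv ℝ χ w.2 v * a ≠ 0 → w.2 ∈ closedBall x₀ ρ₁ ∧ w.2 ∉ ball x₀ ρ₂ := by
    intro w v a h
    constructor
    · by_contra h3; exact h (by rw [hχfdzero _ h3, zero_mul])
    · intro h3; exact h (by rw [hχfd_in _ h3, zero_mul])
  have hD1sep : ∀ k w, D1 k w ≠ 0 → w.2 ∈ closedBall x₀ ρ₁ ∧ w.2 ∉ ball x₀ ρ₂ := by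
    intro k w h
    simp only [hD1] at h
    split_ifs at h with h1
    · constructor
      · by_contra h3; exact h (by rw [hχΔzero _ h3, zero_mul])
      · intro h3; exact h (by rw [hχΔ_in _ h3, zero_mul])
    · exact absurd rfl h
  have hD2sep : ∀ k i w, D2 k i w ≠ 0 → w.2 ∈ closedBall x₀ ρ₁ ∧ w.2 ∉ ball x₀ ρ₂ := by
    intro k i w h
    simp only [hD2] at h
    split_ifs at h with h1
    · refine hshell_fd w (b i) (2 * ⟪us w, b k⟫) (fun h' => h ?_)
      have : (2 * fderiv ℝ χ w.2 (b i)) * ⟪us w, b k⟫ = fderiv ℝ χ w.2 (b i) * (2 * ⟪us w, b k⟫) := by ring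
      rw [this, h']
    · exact absurd rfl h
  have hD3sep : ∀ k i w, D3 k i w ≠ 0 → w.2 ∈ closedBall x₀ ρ₁ ∧ w.2 ∉ ball x₀ ρ₂ := by
    intro k i w h
    simp only [hD3] at h
    split_ifs at h with h1
    · exact hshell_fd w (b i) _ h
    · exact absurd rfl h
  have hD5sep : ∀ k w, D5 k w ≠ 0 → w.2 ∈ closedBall x₀ ρ₁ ∧ w.2 ∉ ball x₀ ρ₂ := by
    intro k w h
    simp only [hD5] at h
    split_ifs at h with h1
    · exact hshell_fd w (b k) _ h
    · exact absurd rfl h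
  /- ## the smooth representatives of the shell potentials -/
  have hΦ1ex : ∀ k, ∃ Φ : ℝ × EuclideanSpace ℝ (Fin 3) → ℝ, ContDiff ℝ (⊤ : ℕ∞) Φ ∧
      (∀ m z, ‖iteratedFDeriv ℝ m Φ z‖ ≤ Moff m * ∫ w, ‖D1 k w‖) ∧
      ∀ (t : ℝ) (x : EuclideanSpace ℝ (Fin 3)), t ∈ Icc (0 : ℝ) 1 →
        (∀ w, D1 k w ≠ 0 → d ≤ ‖x - w.2‖ ∧ ‖x - w.2‖ ≤ 2) → heatPotential 1 (D1 k) (t, x) = Φ (t, x) := fun k =>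
    hMoff (D1 k) (hD1i k).1 (hKt1 (hD1K k))
  choose Φ1 hΦ1s hΦ1b hΦ1eq using hΦ1ex
  have hΦ2ex : ∀ k i, ∃ Φ : ℝ × EuclideanSpace ℝ (Fin 3) → ℝ, ContDiff ℝ (⊤ : ℕ∞) Φ ∧
      (∀ m z, ‖iteratedFDeriv ℝ m Φ z‖ ≤ Moff m * ∫ w, ‖D2 k i w‖) ∧
      ∀ (t : ℝ) (x : EuclideanSpace ℝ (Fin 3)), t ∈ Icc (0 : ℝ) 1 →
        (∀ w, D2 k i w ≠ 0 → d ≤ ‖x - w.2‖ ∧ ‖x - w.2‖ ≤ 2) → heatPotential 1 (D2 k i) (t, x) = Φ (t, x) := fun k i =>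
    hMoff (D2 k i) (hD2i k i).1 (hKt1 (hD2K k i))
  choose Φ2 hΦ2s hΦ2b hΦ2eq using hΦ2ex
  have hΦ3ex : ∀ k i, ∃ Φ : ℝ × EuclideanSpace ℝ (Fin 3) → ℝ, ContDiff ℝ (⊤ : ℕ∞) Φ ∧
      (∀ m z, ‖iteratedFDeriv ℝ m Φ z‖ ≤ Moff m * ∫ w, ‖D3 k i w‖) ∧
      ∀ (t : ℝ) (x : EuclideanSpace ℝ (Fin 3)), t ∈ Icc (0 : ℝ) 1 →
        (∀ w, D3 k i w ≠ 0 → d ≤ ‖x - w.2‖ ∧ ‖x - w.2‖ ≤ 2) → heatPotential 1 (D3 k i) (t, x) = Φ (t, x) := fun k i =>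
    hMoff (D3 k i) (hD3i k i).1 (hKt1 (hD3K k i))
  choose Φ3 hΦ3s hΦ3b hΦ3eq using hΦ3ex
  have hΦ5ex : ∀ k, ∃ Φ : ℝ × EuclideanSpace ℝ (Fin 3) → ℝ, ContDiff ℝ (⊤ : ℕ∞) Φ ∧
      (∀ m z, ‖iteratedFDeriv ℝ m Φ z‖ ≤ Moff m * ∫ w, ‖D5 k w‖) ∧
      ∀ (t : ℝ) (x : EuclideanSpace ℝ (Fin 3)), t ∈ Icc (0 : ℝ) 1 →
        (∀ w, D5 k w ≠ 0 → d ≤ ‖x - w.2‖ ∧ ‖x - w.2‖ ≤ 2) → heatPotential 1 (D5 k) (t, x) = Φ (t, x) := fun k =>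
    hMoff (D5 k) (hD5i k).1 (hKt1 (hD5K k))
  choose Φ5 hΦ5s hΦ5b hΦ5eq using hΦ5ex
  -- uniform bounds of all their derivatives up to order `n + 3`
  have hL1le : ∀ {I : ℝ}, I ≤ L₁ → 0 ≤ I → ∀ m ≤ n + 3, Moff m * I ≤ Mon * L₁ := by
    intro I hI hI0 m hm
    calc Moff m * I ≤ Mo m * I := mul_le_mul_of_nonneg_right (le_max_left _ _) hI0
      _ ≤ Mon * L₁ := mul_le_mul (hMole m hm) hI hI0 hMon0
  have hp1 : 0 ≤ 3 * Xn * Kb * V1 := by positivity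
  have hp2 : 0 ≤ 2 * Xn * Kb * V1 := by positivity
  have hp3 : 0 ≤ Xn * Kb ^ 2 * V1 := by positivity
  have hp4 : 0 ≤ Xn * Pp := by positivity
  have hI1 : ∀ k, ∫ w, ‖D1 k w‖ ≤ L₁ := fun k => (hD1i k).2.trans (by rw [hL₁]; linarith)
  have hI2 : ∀ k i, ∫ w, ‖D2 k i w‖ ≤ L₁ := fun k i => (hD2i k i).2.trans (by rw [hL₁]; linarith)
  have hI3 : ∀ k i, ∫ w, ‖D3 k i w‖ ≤ L₁ := fun k i => (hD3i k i).2.trans (by rw [hL₁]; linarith)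
  have hI5 : ∀ k, ∫ w, ‖D5 k w‖ ≤ L₁ := fun k => (hD5i k).2.trans (by rw [hL₁]; linarith)
  have hΦ1B : ∀ k, ∀ m ≤ n + 3, ∀ z, ‖iteratedFDeriv ℝ m (Φ1 k) z‖ ≤ Mon * L₁ := fun k m hm z =>
    (hΦ1b k m z).trans (hL1le (hI1 k) (integral_nonneg fun _ => norm_nonneg _) m hm)
  have hΦ2B : ∀ k i, ∀ m ≤ n + 3, ∀ z, ‖iteratedFDeriv ℝ m (Φ2 k i) z‖ ≤ Mon * L₁ := fun k i m hm z =>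
    (hΦ2b k i m z).trans (hL1le (hI2 k i) (integral_nonneg fun _ => norm_nonneg _) m hm)
  have hΦ3B : ∀ k i, ∀ m ≤ n + 3, ∀ z, ‖iteratedFDeriv ℝ m (Φ3 k i) z‖ ≤ Mon * L₁ := fun k i m hm z =>
    (hΦ3b k i m z).trans (hL1le (hI3 k i) (integral_nonneg fun _ => norm_nonneg _) m hm)
  have hΦ5B : ∀ k, ∀ m ≤ n + 3, ∀ z, ‖iteratedFDeriv ℝ m (Φ5 k) z‖ ≤ Mon * L₁ := fun k m hm z =>
    (hΦ5b k m z).trans (hL1le (hI5 k) (integral_nonneg fun _ => norm_nonneg _) m hm)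
  -- level bounds of slices of a smooth space–time function with bounded derivatives
  have hslice : ∀ {Φ : ℝ × EuclideanSpace ℝ (Fin 3) → ℝ}, ContDiff ℝ (⊤ : ℕ∞) Φ →
      (∀ m ≤ n + 3, ∀ z, ‖iteratedFDeriv ℝ m Φ z‖ ≤ Mon * L₁) → ∀ t : ℝ,
      (ContDiff ℝ (n + 1) (fun x => Φ (t, x)) ∧
        (∀ k ≤ n + 1, ∀ x, ‖iteratedFDeriv ℝ k (fun x => Φ (t, x)) x‖ ≤ 2 * (Mon * L₁)) ∧
        ∀ x y, ‖iteratedFDeriv ℝ (n + 1) (fun x => Φ (t, x)) x - iteratedFDeriv ℝ (n + 1) (fun x => Φ (t, x)) y‖ ≤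
          2 * (Mon * L₁) * ‖x - y‖ ^ γ) ∧
      ∀ v : EuclideanSpace ℝ (Fin 3), ‖v‖ ≤ 1 →
        ContDiff ℝ (n + 1) (fun x => fderiv ℝ (fun y => Φ (t, y)) x v) ∧
        (∀ k ≤ n + 1, ∀ x, ‖iteratedFDeriv ℝ k (fun x => fderiv ℝ (fun y => Φ (t, y)) x v) x‖ ≤ 2 * (Mon * L₁)) ∧
        ∀ x y, ‖iteratedFDeriv ℝ (n + 1) (fun x => fderiv ℝ (fun y => Φ (t, y)) x v) x -
          iteratedFDeriv ℝ (n + 1) (fun x => fderiv ℝ (fun y => Φ (t, y)) x v) y‖ ≤ 2 * (Mon * L₁) * ‖x - y‖ ^ γ := by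
    intro Φ hΦ hB t
    have hsl : ContDiff ℝ (⊤ : ℕ∞) (fun x => Φ (t, x)) := OffDiagHeat.contDiff_slice hΦ t
    have hsl1 : ContDiff ℝ ((n + 1 + 1 : ℕ) : ℕ∞) (fun x => Φ (t, x)) := hsl.of_le (by exact_mod_cast le_top)
    have hsl2 : ContDiff ℝ ((n + 2 + 1 : ℕ) : ℕ∞) (fun x => Φ (t, x)) := hsl.of_le (by exact_mod_cast le_top)
    have hslB : ∀ m ≤ n + 3, ∀ x, ‖iteratedFDeriv ℝ m (fun x => Φ (t, x)) x‖ ≤ Mon * L₁ := fun m hm x =>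
      (OffDiagHeat.norm_iteratedFDeriv_slice_le hΦ t m x).trans (hB m hm _)
    refine ⟨level_of_succ_bound (m := n + 1) hsl1 (fun k hk x => hslB k (by omega) x) hγ0 hγ1.le,
      fun v hv => ?_⟩
    -- the directional derivative: level `n + 2` bounds of the slice first
    obtain ⟨h1, h2, h3⟩ := level_of_succ_bound (m := n + 2) hsl2
      (fun k hk x => hslB k (by omega) x) hγ0 hγ1.le
    exact level_fderiv_apply h1 h2 h3 hv
  /- ## the caloric term -/
  set gk : Fin 3 → (EuclideanSpace ℝ (Fin 3)) → ℝ := fun k y => χ y * ⟪u₀ y, b k⟫ with hgk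
  have hgk : ∀ k, (∀ m : ℕ, ContDiff ℝ m (gk k)) ∧ ∀ (m : ℕ) (x : EuclideanSpace ℝ (Fin 3)),
      ‖iteratedFDeriv ℝ m (gk k) x‖ ≤ Bc m := by
    intro k
    obtain ⟨h1, h2⟩ := smooth_cutoff_datum hu₀s hAd hχs hρ₁1 hχsupp hX0 hχX hAd0 (b k)
    refine ⟨h1, fun m x => (h2 m x).trans ?_⟩
    rw [hb1, one_mul]
  set cal : Fin 3 → ℝ → (EuclideanSpace ℝ (Fin 3)) → ℝ := fun k t x =>
    if 0 < t then heatExtension (gk k) t x else gk k x with hcal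
  have hcalL : ∀ k t, ContDiff ℝ (n + 1) (cal k t) ∧ (∀ m ≤ n + 1, ∀ x, ‖iteratedFDeriv ℝ m (cal k t) x‖ ≤ 2 * Bn) ∧
      ∀ x y, ‖iteratedFDeriv ℝ (n + 1) (cal k t) x - iteratedFDeriv ℝ (n + 1) (cal k t) y‖ ≤ 2 * Bn * ‖x - y‖ ^ γ := by
    intro k t
    obtain ⟨h1, h2, -⟩ := caloric_level_bounds (hgk k).1 (hgk k).2 t
    exact level_of_succ_bound (m := n + 1) (h1 (n + 2)) (fun m hm x => (h2 m x).trans (hBle m (by omega))) hγ0 hγ1.le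
  /- ## the Duhamel integrals of the inner data -/
  have hg4L : ∀ k i s, ContDiff ℝ n (g4 k i s) ∧ (∀ m ≤ n, ∀ y, ‖iteratedFDeriv ℝ m (g4 k i s) y‖ ≤ Md) ∧
      ∀ y z, ‖iteratedFDeriv ℝ n (g4 k i s) y - iteratedFDeriv ℝ n (g4 k i s) z‖ ≤ Md * ‖y - z‖ ^ γ := by
    intro k i s
    by_cases hs : s ∈ Ioo 0 Tb
    · have e : g4 k i s = fun y => χ y * (⟪R s y, b i⟫ * ⟪R s y, b k⟫) := by
        funext y; simp only [hg4, hs, if_true]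
      rw [e]
      exact hKd hγ0 hγ1.le hXn0 (hRn s) (hRb s) (hRH s) (hχs.of_le (by exact_mod_cast le_top))
        (fun m hm y => (hχX m y).trans (hXle m (by omega))) (hb1 i).le (hb1 k).le
    · have e : g4 k i s = fun _ => (0 : ℝ) := by
        funext y; simp only [hg4, hs, if_false]
      rw [e]
      obtain ⟨h1, h2, h3⟩ := level_zero (F := ℝ) (m := n) (γ := γ)
      exact ⟨h1, (level_mono hMd0 h2 h3).1, (level_mono hMd0 h2 h3).2⟩
  have hg4sm : ∀ k i, StronglyMeasurable (uncurry (g4 k i)) := fun k i => (hg4m k i).stronglyMeasurable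
  set J4 : Fin 3 → Fin 3 → ℝ → (EuclideanSpace ℝ (Fin 3)) → ℝ := fun k i t x =>
    ∫ s in Ioo 0 (min t 1), heatExtension (g4 k i s) (min t 1 - s) x with hJ4
  have hJ4L : ∀ k i t, ContDiff ℝ (n + 2) (J4 k i t) ∧ (∀ m ≤ n + 2, ∀ x, ‖iteratedFDeriv ℝ m (J4 k i t) x‖ ≤ Ce * Md) ∧
      ∀ x y, ‖iteratedFDeriv ℝ (n + 2) (J4 k i t) x - iteratedFDeriv ℝ (n + 2) (J4 k i t) y‖ ≤ Ce * Md * ‖x - y‖ ^ γ := by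
    intro k i t
    by_cases ht : 0 < min t 1
    · exact hCe hMd0 (hg4sm k i) (fun s => (hg4L k i s).1) (fun s m hm y => (hg4L k i s).2.1 m hm y)
        (fun s y z => (hg4L k i s).2.2 y z) ht (min_le_right _ _)
    · have e : J4 k i t = fun _ => (0 : ℝ) := by
        funext x
        simp only [hJ4]
        rw [Ioo_eq_empty_of_le (not_lt.1 ht), Measure.restrict_empty, integral_zero_measure]
      rw [e]
      obtain ⟨h1, h2, h3⟩ := level_zero (F := ℝ) (m := n + 2) (γ := γ)
      have hCM : (0 : ℝ) ≤ Ce * Md := by positivity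
      exact ⟨h1, (level_mono hCM h2 h3).1, (level_mono hCM h2 h3).2⟩
  have hdJ4L : ∀ k i t, ContDiff ℝ (n + 1) (fun x => fderiv ℝ (J4 k i t) x (b i)) ∧
      (∀ m ≤ n + 1, ∀ x, ‖iteratedFDeriv ℝ m (fun x => fderiv ℝ (J4 k i t) x (b i)) x‖ ≤ Ce * Md) ∧
      ∀ x y, ‖iteratedFDeriv ℝ (n + 1) (fun x => fderiv ℝ (J4 k i t) x (b i)) x -
        iteratedFDeriv ℝ (n + 1) (fun x => fderiv ℝ (J4 k i t) x (b i)) y‖ ≤ Ce * Md * ‖x - y‖ ^ γ := fun k i t =>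
    level_fderiv_apply (hJ4L k i t).1 (hJ4L k i t).2.1 (hJ4L k i t).2.2 (hb1 i).le
  /- ## the fields `V` and `Q` -/
  set V : Fin 3 → ℝ → (EuclideanSpace ℝ (Fin 3)) → ℝ := fun k t x =>
    (Φ1 k (t, x) + ∑ i, Φ3 k i (t, x) + Φ5 k (t, x) + cal k t x) +
      -(∑ i, fderiv ℝ (fun y => Φ2 k i (t, y)) x (b i) + ∑ i, fderiv ℝ (J4 k i t) x (b i)) with hV
  set Q : ℝ → (EuclideanSpace ℝ (Fin 3)) → ℝ := fun t x => heatPotential 1 D6 (t, x) with hQ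
  -- level bounds of `V`
  have hVL : ∀ k t, ContDiff ℝ (n + 1) (V k t) ∧ (∀ m ≤ n + 1, ∀ x, ‖iteratedFDeriv ℝ m (V k t) x‖ ≤ 𝒱) ∧
      ∀ x y, ‖iteratedFDeriv ℝ (n + 1) (V k t) x - iteratedFDeriv ℝ (n + 1) (V k t) y‖ ≤ 𝒱 * ‖x - y‖ ^ γ := by
    intro k t
    obtain ⟨a1, a2, a3⟩ := (hslice (hΦ1s k) (hΦ1B k) t).1
    have b123 : ∀ i, _ := fun i => (hslice (hΦ3s k i) (hΦ3B k i) t).1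
    obtain ⟨b1, b2, b3⟩ := level_sum3 (fun i => (b123 i).1) (fun i => (b123 i).2.1) (fun i => (b123 i).2.2)
    obtain ⟨c1, c2, c3⟩ := (hslice (hΦ5s k) (hΦ5B k) t).1
    obtain ⟨d1, d2, d3⟩ := hcalL k t
    have e123 : ∀ i, _ := fun i => (hslice (hΦ2s k i) (hΦ2B k i) t).2 (b i) (hb1 i).le
    obtain ⟨e1, e2, e3⟩ := level_sum3 (fun i => (e123 i).1) (fun i => (e123 i).2.1) (fun i => (e123 i).2.2)
    obtain ⟨f1, f2, f3⟩ := level_sum3 (fun i => (hdJ4L k i t).1) (fun i => (hdJ4L k i t).2.1) (fun i => (hdJ4L k i t).2.2)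
    obtain ⟨g1, g2, g3⟩ := level_add a1 a2 a3 b1 b2 b3
    obtain ⟨h1, h2, h3⟩ := level_add g1 g2 g3 c1 c2 c3
    obtain ⟨i1, i2, i3⟩ := level_add h1 h2 h3 d1 d2 d3
    obtain ⟨j1, j2, j3⟩ := level_add e1 e2 e3 f1 f2 f3
    obtain ⟨k1, k2, k3⟩ := level_neg j1 j2 j3
    obtain ⟨l1, l2, l3⟩ := level_add i1 i2 i3 k1 k2 k3
    have hle : 2 * (Mon * L₁) + 3 * (2 * (Mon * L₁)) + 2 * (Mon * L₁) + 2 * Bn + (3 * (2 * (Mon * L₁)) + 3 * (Ce * Md)) ≤ 𝒱 := by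
      rw [h𝒱]; nlinarith [hMon0, hL₁0, hBn0, hCe0, hMd0, hXn0, hPp0]
    obtain ⟨m2, m3⟩ := level_mono hle l2 l3
    exact ⟨l1, m2, m3⟩
  -- `Q`
  have hQm : Measurable (uncurry Q) := by
    have : uncurry Q = heatPotential 1 D6 := by funext w; rfl
    rw [this]; exact measurable_heatPotential hD6m
  have hQi : ∀ t, Integrable (Q t) volume ∧ ∫ x, ‖Q t x‖ ≤ 𝒱 := by
    intro t
    obtain ⟨h1, h2⟩ := integrable_heatPotential_slice hD6m hD6i.1 t
    refine ⟨h1, h2.trans (hD6i.2.trans ?_)⟩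
    rw [h𝒱]; nlinarith [hMon0, hL₁0, hBn0, hCe0, hMd0, hXn0, hPp0]
  /- ## measurability of `V` -/
  have hmeas_fd : ∀ {G : ℝ → (EuclideanSpace ℝ (Fin 3)) → ℝ}, StronglyMeasurable (uncurry G) →
      (∀ t, Differentiable ℝ (G t)) → ∀ v : EuclideanSpace ℝ (Fin 3),
      StronglyMeasurable fun w : ℝ × EuclideanSpace ℝ (Fin 3) => fderiv ℝ (G w.1) w.2 v := by
    intro G hGm hGd v
    have h := HeatHolder.stronglyMeasurable_fderiv_family hGm hGd
    have h2 : StronglyMeasurable fun w : ℝ × EuclideanSpace ℝ (Fin 3) => (uncurry (fun s y => fderiv ℝ (G s) y) w) v :=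
      (ContinuousLinearMap.apply ℝ ℝ v).continuous.comp_stronglyMeasurable h
    exact h2
  have hVm : ∀ k, StronglyMeasurable (uncurry (V k)) := by
    intro k
    have m1 : StronglyMeasurable fun w : ℝ × EuclideanSpace ℝ (Fin 3) => Φ1 k (w.1, w.2) :=
      ((hΦ1s k).continuous.comp (continuous_fst.prodMk continuous_snd)).stronglyMeasurable
    have m3 : StronglyMeasurable fun w : ℝ × EuclideanSpace ℝ (Fin 3) => ∑ i, Φ3 k i (w.1, w.2) := by
      refine Finset.stronglyMeasurable_fun_sum _ fun i _ => ?_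
      exact ((hΦ3s k i).continuous.comp (continuous_fst.prodMk continuous_snd)).stronglyMeasurable
    have m5 : StronglyMeasurable fun w : ℝ × EuclideanSpace ℝ (Fin 3) => Φ5 k (w.1, w.2) :=
      ((hΦ5s k).continuous.comp (continuous_fst.prodMk continuous_snd)).stronglyMeasurable
    have mc : StronglyMeasurable fun w : ℝ × EuclideanSpace ℝ (Fin 3) => cal k w.1 w.2 :=
      (measurable_caloric ((hgk k).1 0).continuous).stronglyMeasurable
    have m2 : StronglyMeasurable fun w : ℝ × EuclideanSpace ℝ (Fin 3) => ∑ i, fderiv ℝ (fun y => Φ2 k i (w.1, y)) w.2 (b i) := by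
      refine Finset.stronglyMeasurable_fun_sum _ fun i _ => ?_
      refine hmeas_fd (G := fun t y => Φ2 k i (t, y)) ?_ (fun t => ?_) (b i)
      · exact (hΦ2s k i).continuous.stronglyMeasurable
      · exact (OffDiagHeat.contDiff_slice (hΦ2s k i) t).differentiable (by simp)
    have mJ : StronglyMeasurable fun w : ℝ × EuclideanSpace ℝ (Fin 3) => ∑ i, fderiv ℝ (J4 k i w.1) w.2 (b i) := by
      refine Finset.stronglyMeasurable_fun_sum _ fun i _ => ?_
      refine hmeas_fd (G := J4 k i) ?_ (fun t => (hJ4L k i t).1.differentiable (by simp)) (b i)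
      have h0 := stronglyMeasurable_uncurry_duhamel (hg4m k i)
      have e : uncurry (J4 k i) = (uncurry fun t x => ∫ s in Ioo 0 t, heatExtension (g4 k i s) (t - s) x) ∘
          fun w : ℝ × EuclideanSpace ℝ (Fin 3) => (min w.1 1, w.2) := by
        funext w; rfl
      rw [e]
      exact (h0.measurable.comp ((measurable_fst.min measurable_const).prodMk measurable_snd)).stronglyMeasurable
    have e : uncurry (V k) = fun w : ℝ × EuclideanSpace ℝ (Fin 3) =>
        (Φ1 k (w.1, w.2) + ∑ i, Φ3 k i (w.1, w.2) + Φ5 k (w.1, w.2) + cal k w.1 w.2) +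
          -(∑ i, fderiv ℝ (fun y => Φ2 k i (w.1, y)) w.2 (b i) + ∑ i, fderiv ℝ (J4 k i w.1) w.2 (b i)) := by
      funext w; rfl
    rw [e]
    exact (((m1.add m3).add m5).add mc).add (m2.add mJ).neg
  /- ## the a.e. slice identities -/
  have hident : ∀ᵐ t ∂(volume.restrict (Ioo 0 Tb)),
      (∀ φ : (EuclideanSpace ℝ (Fin 3)) → ℝ,
        FunctionSpaces.IsTestFunctionOn (⟨ball x₀ ρ₃, isOpen_ball⟩ : Opens (EuclideanSpace ℝ (Fin 3))) φ →
        ∀ k : Fin 3, ∫ x, ⟪u t x, b k⟫ * φ x = (∫ x, V k t x * φ x) + ∫ x, Q t x * fderiv ℝ φ x (b k)) ∧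
      IsWeaklyDivFree (u t) ∧ LocallyIntegrable (u t) volume := by
    have hstripm : MeasurableSet (Ioo 0 Tb ×ˢ (univ : Set (EuclideanSpace ℝ (Fin 3)))) := measurableSet_Ioo.prod MeasurableSet.univ
    have hstripS : Ioo 0 Tb ×ˢ (univ : Set (EuclideanSpace ℝ (Fin 3))) ⊆ S := Set.prod_mono (Ioo_subset_Ioo_right hTbTb'.le) Subset.rfl
    -- (T2) slices of `us = u`
    have hus_tx : ∀ᵐ t ∂(volume : Measure ℝ), ∀ᵐ x ∂(volume : Measure (EuclideanSpace ℝ (Fin 3))), (t, x) ∈ S → us (t, x) = u t x := by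
      have h := hus
      rw [Measure.volume_eq_prod] at h
      exact Measure.ae_ae_of_ae_prod h
    have hus_slice : ∀ᵐ t ∂(volume.restrict (Ioo 0 Tb)), ∀ᵐ x ∂(volume : Measure (EuclideanSpace ℝ (Fin 3))), us (t, x) = u t x := by
      rw [ae_restrict_iff' measurableSet_Ioo]
      filter_upwards [hus_tx] with t ht htI
      filter_upwards [ht] with x hx
      exact hx ⟨⟨htI.1, htI.2.trans hTbTb'⟩, mem_univ _⟩
    -- `R = us` a.e. on `(0,T_b) × B(x₀, ρ)`
    have hRus : ∀ᵐ w ∂(volume : Measure (ℝ × EuclideanSpace ℝ (Fin 3))),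
        w.1 ∈ Ioo 0 Tb → w.2 ∈ ball x₀ ρ → R w.1 w.2 = us w := by
      have hP : MeasurableSet {w : ℝ × EuclideanSpace ℝ (Fin 3) | w.1 ∈ Ioo 0 Tb → w.2 ∈ ball x₀ ρ → R w.1 w.2 = us w} := by
        have h1 : MeasurableSet {w : ℝ × EuclideanSpace ℝ (Fin 3) | w.1 ∈ Ioo 0 Tb} := measurable_fst measurableSet_Ioo
        have h2 : MeasurableSet {w : ℝ × EuclideanSpace ℝ (Fin 3) | w.2 ∈ ball x₀ ρ} := measurable_snd measurableSet_ball
        have h3 : MeasurableSet {w : ℝ × EuclideanSpace ℝ (Fin 3) | R w.1 w.2 = us w} :=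
          measurableSet_eq_fun (hRm.measurable : Measurable (uncurry R)) husm
        have : {w : ℝ × EuclideanSpace ℝ (Fin 3) | w.1 ∈ Ioo 0 Tb → w.2 ∈ ball x₀ ρ → R w.1 w.2 = us w} =
            {w : ℝ × EuclideanSpace ℝ (Fin 3) | w.1 ∈ Ioo 0 Tb}ᶜ ∪ ({w | w.2 ∈ ball x₀ ρ}ᶜ ∪ {w | R w.1 w.2 = us w}) := by
          ext w; simp only [mem_setOf_eq, mem_union, mem_compl_iff, imp_iff_not_or]
        rw [this]
        exact h1.compl.union (h2.compl.union h3)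
      rw [Measure.volume_eq_prod, Measure.ae_prod_iff_ae_ae hP]
      have hRu' := (ae_restrict_iff' measurableSet_Ioo).1 hRu
      filter_upwards [hRu', hus_tx] with t ht1 ht2
      by_cases htI : t ∈ Ioo 0 Tb
      · have h1 := (ae_restrict_iff' measurableSet_ball).1 (ht1 htI)
        filter_upwards [h1, ht2] with x hx1 hx2 _ hxB
        rw [hx1 hxB, hx2 ⟨⟨htI.1, htI.2.trans hTbTb'⟩, mem_univ _⟩]
      · exact Eventually.of_forall fun x h => absurd h htI
    have hD4ae : ∀ k i, ∀ᵐ w ∂(volume : Measure (ℝ × EuclideanSpace ℝ (Fin 3))), D4 k i w = D4' k i w := by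
      intro k i
      filter_upwards [hRus] with w hw
      simp only [hD4, hD4', hg4]
      by_cases hwI : w.1 ∈ Ioo 0 Tb
      · rw [if_pos hwI.2, if_pos hwI]
        by_cases hwx : w.2 ∈ closedBall x₀ ρ₁
        · rw [hw hwI ((closedBall_subset_ball hρ₁ρ) hwx)]
        · rw [hχzero _ hwx, zero_mul, zero_mul]
      · rw [if_neg hwI]
        split_ifs with h1
        · have hwS : w ∉ S := fun h => hwI ⟨h.1.1, h1⟩
          rw [hus0 w hwS, inner_zero_left, zero_mul, mul_zero]
        · rfl
    have hD44' : ∀ k i (w : ℝ × EuclideanSpace ℝ (Fin 3)), multiplierHeatPotential 1 (derivSymbol (b i)) (D4 k i) w =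
        multiplierHeatPotential 1 (derivSymbol (b i)) (D4' k i) w := by
      intro k i w
      simp only [multiplierHeatPotential]
      refine integral_congr_ae ?_
      filter_upwards [hD4ae k i] with w' hw'
      rw [hw']
    -- (T3) divergence-free slices
    have hdiv : ∀ᵐ t ∂(volume.restrict (Ioo 0 Tb)), IsWeaklyDivFree (u t) := by
      have hab : Ioo 0 Tb ×ˢ (univ : Set (EuclideanSpace ℝ (Fin 3))) ⊆
          ((slab (EuclideanSpace ℝ (Fin 3)) (Ioo 0 T') isOpen_Ioo : Opens (ℝ × EuclideanSpace ℝ (Fin 3))) :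
            Set (ℝ × EuclideanSpace ℝ (Fin 3))) := fun z hz =>
        mem_slab.2 ⟨hz.1.1, hz.1.2.trans_le (hTbTb'.le.trans hTb'T')⟩
      exact (ae_restrict_iff' measurableSet_Ioo).2 (SuitableRestart.ae_isWeaklyDivFree_slice hu.suitable hab)
    -- (T4) local integrability of the slices
    have hloc : ∀ᵐ t ∂(volume.restrict (Ioo 0 Tb)), LocallyIntegrable (u t) volume := by
      have h := ae_slice_aestronglyMeasurable_and_lintegral_ball_lt_top hu.aestronglyMeasurable (fun K hK => hu.sqIntegrable K hK)
      have h' := ae_restrict_of_ae_restrict_of_subset (Ioo_subset_Ioo_right (hTbTb'.le.trans hTb'T')) h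
      filter_upwards [h'] with t ht
      rw [locallyIntegrable_iff]
      intro K' hK'
      obtain ⟨r, hr⟩ := hK'.isBounded.subset_closedBall (0 : EuclideanSpace ℝ (Fin 3))
      have hsub : K' ⊆ closedBall (0 : EuclideanSpace ℝ (Fin 3)) (⌈max r 0⌉₊ : ℕ) :=
        hr.trans (closedBall_subset_closedBall ((le_max_left _ _).trans (Nat.le_ceil _)))
      refine IntegrableOn.mono_set ?_ hsub
      haveI : IsFiniteMeasure ((volume : Measure (EuclideanSpace ℝ (Fin 3))).restrict (closedBall (0 : EuclideanSpace ℝ (Fin 3)) (⌈max r 0⌉₊ : ℕ))) :=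
        ⟨by rw [Measure.restrict_apply_univ]; exact measure_closedBall_lt_top⟩
      exact BradshawTsai2019.integrable_of_lintegral_rpow_enorm_lt_top ht.1.restrict (by norm_num : (1 : ℝ) ≤ 2)
        (by simpa using ht.2 ⌈max r 0⌉₊)
    -- (T1) the sliced weak representation of `χ us_k`
    have hsl : ∀ k, ∀ᵐ t ∂(volume.restrict (Ioo 0 Tb)), ∀ φ : (EuclideanSpace ℝ (Fin 3)) → ℝ,
        FunctionSpaces.IsTestFunctionOn (⊤ : Opens (EuclideanSpace ℝ (Fin 3))) φ →
        ∫ x, (χ x * ⟪us (t, x), b k⟫ - (heatPotential 1 (D1 k) (t, x) + ∑ i, heatPotential 1 (D3 k i) (t, x) +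
            heatPotential 1 (D5 k) (t, x) + cal k t x)) * φ x =
          (∑ i, ∫ x, (heatPotential 1 (D2 k i) (t, x) + heatPotential 1 (D4' k i) (t, x)) * fderiv ℝ φ x (b i)) +
            ∫ x, heatPotential 1 D6 (t, x) * fderiv ℝ φ x (b k) := by
      intro k
      -- local integrability of `L` and `A`
      have hLi : LocallyIntegrable (fun z : ℝ × EuclideanSpace ℝ (Fin 3) => χ z.2 * ⟪us z, b k⟫) volume := by
        rw [locallyIntegrable_iff]
        intro K' hK'
        have h1 : IntegrableOn (fun z : ℝ × EuclideanSpace ℝ (Fin 3) => ⟪us z, b k⟫) K' volume :=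
          (husi.integrableOn_isCompact hK').inner_const (b k)
        refine Integrable.bdd_mul (c := 1) h1 (hmχ.aestronglyMeasurable) (Eventually.of_forall fun z => ?_)
        rw [Real.norm_eq_abs]; exact hχabs _
      have hcalb : ∀ t x, |cal k t x| ≤ Bc 0 := by
        intro t x
        obtain ⟨-, h2, -⟩ := caloric_level_bounds (hgk k).1 (hgk k).2 t
        have := h2 0 x
        rwa [norm_iteratedFDeriv_zero, Real.norm_eq_abs] at this
      have hcali : LocallyIntegrable (fun z : ℝ × EuclideanSpace ℝ (Fin 3) => cal k z.1 z.2) volume := by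
        have hm : Measurable fun z : ℝ × EuclideanSpace ℝ (Fin 3) => cal k z.1 z.2 :=
          measurable_caloric ((hgk k).1 0).continuous
        rw [locallyIntegrable_iff]
        intro K' hK'
        exact Measure.integrableOn_of_bounded hK'.measure_lt_top.ne hm.aestronglyMeasurable
          (Eventually.of_forall fun z => by rw [Real.norm_eq_abs]; exact hcalb _ _)
      have hP1 : LocallyIntegrable (fun z : ℝ × EuclideanSpace ℝ (Fin 3) => heatPotential 1 (D1 k) z) volume :=
        HeatPotentialSlice.locallyIntegrable_heatPotential (hD1i k).1 (hKtae (hD1K k))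
      have hP3 : LocallyIntegrable (fun z : ℝ × EuclideanSpace ℝ (Fin 3) => ∑ i, heatPotential 1 (D3 k i) z) volume :=
        locallyIntegrable_finsetSum _ fun i _ => HeatPotentialSlice.locallyIntegrable_heatPotential (hD3i k i).1 (hKtae (hD3K k i))
      have hP5 : LocallyIntegrable (fun z : ℝ × EuclideanSpace ℝ (Fin 3) => heatPotential 1 (D5 k) z) volume :=
        HeatPotentialSlice.locallyIntegrable_heatPotential (hD5i k).1 (hKtae (hD5K k))
      have hAi : LocallyIntegrable (fun z : ℝ × EuclideanSpace ℝ (Fin 3) => heatPotential 1 (D1 k) z +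
          ∑ i, heatPotential 1 (D3 k i) z + heatPotential 1 (D5 k) z + cal k z.1 z.2) volume :=
        ((hP1.add hP3).add hP5).add hcali
      -- the representation on the strip, with `us` and `D4'`
      have hrepk := hrep hχs hχsupp' (b k)
      simp only [← hb_def] at hrepk
      have husS : ∀ᵐ z ∂(volume.restrict (Ioo 0 Tb ×ˢ (univ : Set (EuclideanSpace ℝ (Fin 3))))), us z = u z.1 z.2 :=
        (ae_restrict_iff' hstripm).2 (hus.mono fun z hz hzs => hz (hstripS hzs))
      have hrep'' : ∀ᵐ z ∂(volume.restrict (Ioo 0 Tb ×ˢ (univ : Set (EuclideanSpace ℝ (Fin 3))))),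
          (fun z : ℝ × EuclideanSpace ℝ (Fin 3) => χ z.2 * ⟪us z, b k⟫) z =
            (fun z : ℝ × EuclideanSpace ℝ (Fin 3) => heatPotential 1 (D1 k) z + ∑ i, heatPotential 1 (D3 k i) z +
              heatPotential 1 (D5 k) z + cal k z.1 z.2) z
            + ∑ i, (-(multiplierHeatPotential 1 (derivSymbol (b i)) (D2 k i) z).re)
            + ∑ i, (-(multiplierHeatPotential 1 (derivSymbol (b i)) (D4' k i) z).re)
            + (-(multiplierHeatPotential 1 (derivSymbol (b k)) D6 z).re) := by
        filter_upwards [hrepk, husS, ae_restrict_mem hstripm] with z hz hzu hzs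
        simp only [hzu]
        rw [hz]
        simp only [← hD44', hcal, hzs.1.1, if_true, hD1, hD2, hD3, hD4, hD5, hD6]
        ring
      have hmain := HeatPotentialSlice.ae_slice_weak_representation (T := Tb)
        (L := fun z : ℝ × EuclideanSpace ℝ (Fin 3) => χ z.2 * ⟪us z, b k⟫)
        (A := fun z : ℝ × EuclideanSpace ℝ (Fin 3) => heatPotential 1 (D1 k) z + ∑ i, heatPotential 1 (D3 k i) z +
              heatPotential 1 (D5 k) z + cal k z.1 z.2)
        hLi hAi (fun i => (hD2i k i).1) (fun i => hKtae (hD2K k i)) (fun i => hD4'i k i) (fun i => hKtae (hg4K k i))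
        hD6i.1 (hKtae hD6K) (fun i => b i) (b k) hrep''
      filter_upwards [hmain] with t ht φ hφ
      exact ht φ hφ
    have hslall : ∀ᵐ t ∂(volume.restrict (Ioo 0 Tb)), ∀ k, ∀ φ : (EuclideanSpace ℝ (Fin 3)) → ℝ,
        FunctionSpaces.IsTestFunctionOn (⊤ : Opens (EuclideanSpace ℝ (Fin 3))) φ →
        ∫ x, (χ x * ⟪us (t, x), b k⟫ - (heatPotential 1 (D1 k) (t, x) + ∑ i, heatPotential 1 (D3 k i) (t, x) +
            heatPotential 1 (D5 k) (t, x) + cal k t x)) * φ x =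
          (∑ i, ∫ x, (heatPotential 1 (D2 k i) (t, x) + heatPotential 1 (D4' k i) (t, x)) * fderiv ℝ φ x (b i)) +
            ∫ x, heatPotential 1 D6 (t, x) * fderiv ℝ φ x (b k) :=
      ae_all_iff.2 hsl
    -- (T5) the identity for good times
    filter_upwards [hslall, hus_slice, hdiv, hloc, ae_restrict_mem measurableSet_Ioo] with t hst hust hdivt hloct htI
    refine ⟨fun φ hφ k => ?_, hdivt, hloct⟩
    have ht01 : t ∈ Icc (0 : ℝ) 1 := ⟨htI.1.le, htI.2.le.trans hTb1'⟩
    have hφ' : FunctionSpaces.IsTestFunctionOn (⊤ : Opens (EuclideanSpace ℝ (Fin 3))) φ :=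
      ⟨hφ.contDiff, hφ.hasCompactSupport, fun _ _ => trivial⟩
    have hφc : Continuous φ := hφ.contDiff.continuous
    have hφcs : HasCompactSupport φ := hφ.hasCompactSupport
    have hφ1 : ContDiff ℝ 1 φ := hφ.contDiff.of_le (by exact_mod_cast le_top)
    have hsuppφ : ∀ x, φ x ≠ 0 → x ∈ ball x₀ ρ₃ := fun x hx => hφ.tsupport_subset (subset_tsupport _ hx)
    have hsuppdφ : ∀ x v, fderiv ℝ φ x v ≠ 0 → x ∈ ball x₀ ρ₃ := fun x v hx =>
      hφ.tsupport_subset (tsupport_fderiv_apply_subset ℝ v (subset_tsupport _ hx))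
    have hdφc : ∀ v, Continuous fun x => fderiv ℝ φ x v := fun v =>
      (hφ.contDiff.continuous_fderiv (by simp)).clm_apply continuous_const
    have hdφcs : ∀ v, HasCompactSupport fun x => fderiv ℝ φ x v := fun v => hφcs.fderiv_apply (𝕜 := ℝ) v
    -- pointwise identifications on the inner ball
    have p1 : ∀ x ∈ ball x₀ ρ₃, heatPotential 1 (D1 k) (t, x) = Φ1 k (t, x) := fun x hx =>
      hΦ1eq k t x ht01 (hsep_of (hD1sep k) x hx)
    have p2 : ∀ i, ∀ x ∈ ball x₀ ρ₃, heatPotential 1 (D2 k i) (t, x) = Φ2 k i (t, x) := fun i x hx =>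
      hΦ2eq k i t x ht01 (hsep_of (hD2sep k i) x hx)
    have p3 : ∀ i, ∀ x ∈ ball x₀ ρ₃, heatPotential 1 (D3 k i) (t, x) = Φ3 k i (t, x) := fun i x hx =>
      hΦ3eq k i t x ht01 (hsep_of (hD3sep k i) x hx)
    have p5 : ∀ x ∈ ball x₀ ρ₃, heatPotential 1 (D5 k) (t, x) = Φ5 k (t, x) := fun x hx =>
      hΦ5eq k t x ht01 (hsep_of (hD5sep k) x hx)
    have p4 : ∀ i x, heatPotential 1 (D4' k i) (t, x) = J4 k i t x := by
      intro i x
      rw [HeatPotentialSlice.heatPotential_eq_setIntegral_heatExtension (hD4'm k i) (hD4'b k i) (hKt (hg4K k i)) t x]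
      simp only [hJ4, min_eq_left ht01.2]
      rfl
    -- the smooth part `A♯`
    have hAsc : Continuous fun x => Φ1 k (t, x) + ∑ i, Φ3 k i (t, x) + Φ5 k (t, x) + cal k t x :=
      ((((hslice (hΦ1s k) (hΦ1B k) t).1.1.continuous).add (continuous_finsetSum _ fun i _ =>
        (hslice (hΦ3s k i) (hΦ3B k i) t).1.1.continuous)).add (hslice (hΦ5s k) (hΦ5B k) t).1.1.continuous).add
        (hcalL k t).1.continuous
    -- integrability of the pieces against `φ`
    have hint_c : ∀ {f : (EuclideanSpace ℝ (Fin 3)) → ℝ}, Continuous f → ∀ v, Integrable (fun x => f x * fderiv ℝ φ x v) volume :=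
      fun hf v => (hf.mul (hdφc v)).integrable_of_hasCompactSupport (hdφcs v).mul_left
    have hint_c0 : ∀ {f : (EuclideanSpace ℝ (Fin 3)) → ℝ}, Continuous f → Integrable (fun x => f x * φ x) volume :=
      fun hf => (hf.mul hφc).integrable_of_hasCompactSupport hφcs.mul_left
    have hIu : Integrable (fun x => ⟪u t x, b k⟫ * φ x) volume := by
      have h1 := (hloct.integrable_smul_left_of_hasCompactSupport hφc hφcs).inner_const (𝕜 := ℝ) (b k)
      refine h1.congr (Eventually.of_forall fun x => ?_)
      beta_reduce
      rw [real_inner_smul_left, mul_comm]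
    -- the left-hand side
    have hL : ∫ x, (χ x * ⟪us (t, x), b k⟫ - (heatPotential 1 (D1 k) (t, x) + ∑ i, heatPotential 1 (D3 k i) (t, x) +
        heatPotential 1 (D5 k) (t, x) + cal k t x)) * φ x =
        (∫ x, ⟪u t x, b k⟫ * φ x) - ∫ x, (Φ1 k (t, x) + ∑ i, Φ3 k i (t, x) + Φ5 k (t, x) + cal k t x) * φ x := by
      rw [← integral_sub hIu (hint_c0 hAsc)]
      refine integral_congr_ae ?_
      filter_upwards [hust] with x hx
      by_cases hφx : φ x = 0
      · simp only [hφx, mul_zero, sub_self]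
      · have hxB := hsuppφ x hφx
        rw [hx, hχone x (ball_subset_closedBall (ball_subset_ball hρ₃₂.le hxB)), one_mul, p1 x hxB, p5 x hxB,
          Finset.sum_congr rfl fun i _ => p3 i x hxB]
        ring
    -- the gradient terms
    have hG : ∀ i, ∫ x, (heatPotential 1 (D2 k i) (t, x) + heatPotential 1 (D4' k i) (t, x)) * fderiv ℝ φ x (b i) =
        -∫ x, (fderiv ℝ (fun y => Φ2 k i (t, y)) x (b i) + fderiv ℝ (J4 k i t) x (b i)) * φ x := by
      intro i
      have e1 : ∫ x, (heatPotential 1 (D2 k i) (t, x) + heatPotential 1 (D4' k i) (t, x)) * fderiv ℝ φ x (b i) =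
          ∫ x, (Φ2 k i (t, x) + J4 k i t x) * fderiv ℝ φ x (b i) := by
        refine integral_congr_ae (Eventually.of_forall fun x => ?_)
        beta_reduce
        by_cases hφx : fderiv ℝ φ x (b i) = 0
        · rw [hφx, mul_zero, mul_zero]
        · rw [p2 i x (hsuppdφ x _ hφx), p4 i x]
      have hS2 : ContDiff ℝ 1 (fun y => Φ2 k i (t, y)) := (OffDiagHeat.contDiff_slice (hΦ2s k i) t).of_le (by exact_mod_cast le_top)
      have hS4 : ContDiff ℝ 1 (J4 k i t) := (hJ4L k i t).1.of_le (by exact_mod_cast (show (1 : ℕ) ≤ n + 2 by omega))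
      rw [e1]
      have e2 : ∫ x, (Φ2 k i (t, x) + J4 k i t x) * fderiv ℝ φ x (b i) =
          (∫ x, Φ2 k i (t, x) * fderiv ℝ φ x (b i)) + ∫ x, J4 k i t x * fderiv ℝ φ x (b i) := by
        rw [← integral_add (hint_c hS2.continuous (b i)) (hint_c hS4.continuous (b i))]
        exact integral_congr_ae (Eventually.of_forall fun x => by ring)
      rw [e2, PoissonWeyl.integral_mul_fderiv_apply_eq_neg hS2 hφ1 hφcs (b i),
        PoissonWeyl.integral_mul_fderiv_apply_eq_neg hS4 hφ1 hφcs (b i), ← neg_add,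
        ← integral_add (hint_c0 ((hS2.continuous_fderiv one_ne_zero).clm_apply continuous_const))
          (hint_c0 ((hS4.continuous_fderiv one_ne_zero).clm_apply continuous_const))]
      congr 1
      exact integral_congr_ae (Eventually.of_forall fun x => by ring)
    -- `∫ V φ`
    have hdc : ∀ i, Continuous fun x => fderiv ℝ (fun y => Φ2 k i (t, y)) x (b i) + fderiv ℝ (J4 k i t) x (b i) := fun i =>
      ((((OffDiagHeat.contDiff_slice (hΦ2s k i) t).of_le (by exact_mod_cast le_top) : ContDiff ℝ 1 _).continuous_fderiv
        one_ne_zero).clm_apply continuous_const).add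
        ((((hJ4L k i t).1.of_le (by exact_mod_cast (show (1 : ℕ) ≤ n + 2 by omega)) : ContDiff ℝ 1 _).continuous_fderiv one_ne_zero).clm_apply continuous_const)
    have hVint : ∫ x, V k t x * φ x = (∫ x, (Φ1 k (t, x) + ∑ i, Φ3 k i (t, x) + Φ5 k (t, x) + cal k t x) * φ x) -
        ∑ i, ∫ x, (fderiv ℝ (fun y => Φ2 k i (t, y)) x (b i) + fderiv ℝ (J4 k i t) x (b i)) * φ x := by
      have hVdef : ∀ x, V k t x = (Φ1 k (t, x) + ∑ i, Φ3 k i (t, x) + Φ5 k (t, x) + cal k t x) +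
          -(∑ i, fderiv ℝ (fun y => Φ2 k i (t, y)) x (b i) + ∑ i, fderiv ℝ (J4 k i t) x (b i)) := fun x => rfl
      have e1 : (fun x => V k t x * φ x) = fun x => (Φ1 k (t, x) + ∑ i, Φ3 k i (t, x) + Φ5 k (t, x) + cal k t x) * φ x -
          ∑ i, (fderiv ℝ (fun y => Φ2 k i (t, y)) x (b i) + fderiv ℝ (J4 k i t) x (b i)) * φ x := by
        funext x
        rw [hVdef, ← Finset.sum_add_distrib, add_mul, neg_mul, Finset.sum_mul]
        ring
      rw [e1, integral_sub (hint_c0 hAsc) (integrable_finsetSum _ fun i _ => hint_c0 (hdc i)),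
        integral_finsetSum _ fun i _ => hint_c0 (hdc i)]
    -- assemble
    have hmainφ := hst k φ hφ'
    rw [hL] at hmainφ
    simp only [hG, Finset.sum_neg_distrib] at hmainφ
    rw [hVint]
    have hQ' : ∫ x, Q t x * fderiv ℝ φ x (b k) = ∫ x, heatPotential 1 D6 (t, x) * fderiv ℝ φ x (b k) := rfl
    rw [hQ']
    linarith
  exact ⟨V, Q, hVm, fun k t => (hVL k t).1, fun k t => (hVL k t).2.1, fun k t => (hVL k t).2.2, hQm,
    fun t => (hQi t).1, fun t => (hQi t).2, hident⟩

end JiaSverak2014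

end Literature.Analysis.FluidPDE
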